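import Literature.Analysis.InnerProduct.TwoSphereHeatTraceExpansion
import Literature.Analysis.InnerProduct.TwistedCircleHeatTraceExpansion
import HarnessLib

/-!
# The Dirichlet and Neumann hemispheres `S²₊`: `Z_D(t) = ∑_{l≥1} l·e^{−t·l(l+1)}`, `Z_N(t) = ∑_{l≥0}(l+1)e^{−t·l(l+1)}`,
# `Z_{D/N} = ½Z_{S²} ∓ ½E` with `E(t) = ∑_{l≥0}e^{−t·l(l+1)} = ½e^{t/4}∑_{n∈ℤ}e^{−t(n+½)²} = (√π/2)e^{t/4}t^{−1/2} + O(t^∞)`,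
# hence McKEAN–SINGER'S FORMULA (6) ON THE HEMISPHERE TO ALL ORDERS:
# `Z_{D/N}(t) = 1/(2t) ∓ √π/(4√t) + 1/6 ∓ (√π/16)√t + t/30 ∓ ⋯` — integer powers = HALF of Mulholland's `S²` coefficients,
# half-integer powers = `∓(√π/4)(1/4)^i/i!`; Weyl `#{λ ≤ Λ}/Λ → ½` for both, `ζ_D(0) = 1/6`, `ζ_N(0) = −5/6`, and the
# boundary creates the HALF-INTEGER POLE `s = ½` with residues `∓¼` — McKean–Singer 1967 (6); Freitas–Mao–Salavessa §2.2

Layer `Literature/Analysis/InnerProduct`, namespace `Literature.Analysis.InnerProduct`; sequel BY IMPORT of row g40-#1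
(`TwoSphereHeatTraceExpansion.lean`: REUSED `hasSum_twoSphere`, `isBigO_twoSphere_heatTrace_expansion` (Mulholland to all
orders), `summable_two_mul_add_one_mul_exp_neg_mul_sq`, `twoSphere_heatCoeff_zero/one`) and of `TwistedCircleHeatTraceExpansion.lean`
(REUSED `summable_exp_neg_mul_intCast_add_sq`, `isBigO_tsum_exp_neg_mul_intCast_add_sq_sub`: the theta series `∑_{n∈ℤ}e^{−t(n+a)²}
= √(π/t) + O(t^∞)`, here at `a = ½`); the abstract theory (`HeatTraceExpansionConsequences.lean`, `HeatTraceZetaContinuation.lean`,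
`HeatTraceZetaRegularity.lean`) and the generic multiplicity-family lemmas of `OddSphereHeatTraceExpansion.lean`
(`hasSum_sigma_fin_of_hasSum_natCast_mul`, `tendsto_sigma_fin_cofinite_atTop`, `ncard_setOf_sigma_fin_eq`) do the rest. The
first tree file whose heat expansion has HALF-INTEGER exponents (a boundary): the abstract machinery, written for arbitrary real
exponent families `α : κ → ℝ`, is exercised on `κ = Fin (N+1) ⊕ Fin (N+1)`. Lane `lit-hodgefound` (Track 2 foundations
library), prover seat `lit-hodgefound-p06` (generation 40), self-proposed row g40-#3. THEOREMS ONLY (no definition, no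
instance, no notation, no named fact).

## Sources, verbatim

H. P. McKean, I. M. Singer, *Curvature and the eigenvalues of the Laplacian*, J. Differential Geom. 1 (1967) 43–69, p. 45
(held text `paper:doi-10-4310-jdg-1214427880`, p0003; proved in their §5, formula (2) p. 53): "Consider now an open
`d`-dimensional manifold `D` with compact `(d−1)`-dimensional boundary `B`, `D̄ = D ∪ B` being endowed with a smooth Riemannian
geometry, and let `0 > γ₁⁻ > γ₂⁻ > ⋯` and `0 = γ₀⁺ > γ₁⁺ > γ₂⁺ > ⋯` be the spectra of `Δ⁻ = Δ | C^∞(D̄) ∩ (u : u = 0 on B)`,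
`Δ⁺ = Δ | C^∞(D̄) ∩ (u : u• = 0 on B)` … Bring in also the mean curvature `J` at a point of `B` … and the partition function
`Z± = sp e^{tΔ±} = ∑ exp(γₙ± t)`. Then, as will be proved in §5,
(6) `(4πt)^{d/2} Z± = the (Riemannian) volume of D ± ¼√(4πt) × the (Riemannian) surface area of B + (t/3) × the curvatura
integra ∫_D K − (t/6) × the integrated mean curvature ∫_B J + O(t^{3/2})`" — and, two lines below, "`O(t^{3/2})` cannot
be improved" (the OCR of the held page renders the error term of (6) as `o(t^{3/2})`; MS's remark, its parallel "(5a) … `O(t³)`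
cannot be improved" on p. 44, and the nonzero `t^{3/2}`-coefficient `−π^{3/2}/4` of `(4πt)Z_D(S²₊)` proved below
(`isBigO_dirichletHemisphere_heatTrace_expansion 1`: the term `−(√π/16)√t` of `Z_D`) fix the reading `O(t^{3/2})`).
For the hemisphere `D = S²₊` (`d = 2`): `vol D = 2π`, `area B = length of the equator = 2π`, `K ≡ 1`, `J ≡ 0` (the equator is a
great circle), so `(4πt)Z∓ = 2π ∓ ¼√(4πt)·2π + (t/3)·2π + O(t^{3/2})`, i.e. `Z_{D/N}(t) = 1/(2t) ∓ √π/(4√t) + 1/6 + O(√t)`.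
P. Freitas, J. Mao, I. Salavessa, *Pólya-type inequalities on spheres and hemispheres*, Ann. Inst. Fourier (2025),
arXiv:2204.07277 (held text `paper:arxiv-2204.07277`), §2.2 "Eigenvalues of `S^n_+`" (chunk p0006): "The distinct eigenvalues
of `S^n_+` are given by `λ̄_K = K(K+n−1)`, `K = 1, 2, …`, with multiplicity `m(K) = binom(n+K−2, n−1)`" (`n = 2`: `K(K+1)` with
multiplicity `K` — the Dirichlet family `⟨l, c⟩ ↦ l(l+1)` on `Σ l, Fin l` below), and §1.3 (chunk p0004): "the spectrum of
`Sⁿ` consists of the union of the Dirichlet and Neumann spectra on `Sⁿ₊`" (so the Neumann eigenvalue `l(l+1)`, `l ≥ 0`, has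
multiplicity `(2l+1) − l = l+1`: the family on `Σ l, Fin (l+1)`; `tsum_dirichletHemisphere_add_tsum_neumannHemisphere`).
R. K. Pathria, P. D. Beale, *Statistical Mechanics*, 3rd ed. (2011), §6.5 eq. (20) (Mulholland's formula `j_rot = T/Θ_r + 1/3
+ (1/15)(Θ_r/T) + (4/315)(Θ_r/T)² + ⋯`, the `S²` coefficients `a_k` halved below).
P. H. Bérard, *Spectral Geometry* (LNM 1207, 1986), Ch. V nº6 (ii) (the Poisson summation formula ∕ Jacobi transformation of
theta series — here `∑_{n∈ℤ}e^{−t(n+½)²} = √(π/t)∑_k(−1)^k e^{−π²k²/t}`), Ch. VII nº2 (`a₀ = Vol`), nº10 (ii) (Weyl's formula).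
P. B. Gilkey, *Invariance theory …* (2nd ed., 1995), §1.10 Lemma 1.10.1 (poles of `Γ(s)ζ(s,P)` at `s = (m−n)/d` with residues
`aₙ(P)Γ((m−n)/d)^{−1}`, regular values at `s = 0, −1, …`, zero modes).

## The computation

(1) `l(l+1) = (l+½)² − ¼` and `n ↦ −1−n` pairs `ℤ_{<0}` with `ℤ_{≥0}` preserving `(n+½)²`, so `E(t) = ∑_{l≥0}e^{−t·l(l+1)} =
e^{t/4}∑_{l≥0}e^{−t(l+½)²} = ½e^{t/4}∑_{n∈ℤ}e^{−t(n+½)²}`; by the twisted-circle theta transformation `∑_{n∈ℤ}e^{−t(n+½)²} −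
√π·t^{−1/2} = O(t^β)` for every `β`, hence `E(t) − (√π/2)e^{t/4}t^{−1/2} = O(t^β)` for every `β`. (2) `Z_D = ∑ l·e^{−t·l(l+1)} =
½(∑(2l+1)e^{−t·l(l+1)} − E) = ½(Z_{S²} − E)`, `Z_N = ∑(l+1)e^{−t·l(l+1)} = ½(Z_{S²} + E)`; `Z_D + Z_N = Z_{S²}`, `Z_N − Z_D = E`.
(3) With g40-#1 (`Z_{S²} − ∑_{k≤N}a_k t^{k−1} = O(t^N)`, `a₀ = 1`, `a₁ = 1/3`, `a₂ = 1/15`, `a₃ = 4/315`) and `e^{t/4} −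
∑_{i≤N}(t/4)^i/i! = O(t^{N+1})`: `Z_{D/N}(t) − [∑_{k≤N}(a_k/2)t^{k−1} ∓ (√π/4)∑_{i≤N}((1/4)^i/i!)t^{i−1/2}] = O(t^N)`, written on
the index set `Fin (N+1) ⊕ Fin (N+1)` (integer ⊕ half-integer powers); the first terms `1/(2t) ∓ √π/(4√t) + 1/6 ∓ (√π/16)√t +
t/30`. (4) The machinery: Weyl `#{λ ≤ Λ}/Λ → (a₀/2)/Γ(2) = ½` (the exponent `−½ > −1` is invisible); at `s = 0` only the
exponent-`0` term counts: `ζ_D(0) = a₁/2 − 0 = 1/6`, `ζ_N(0) = a₁/2 − #{l(l+1) = 0} = 1/6 − 1 = −5/6`; at `s = ½` only the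
exponent-`(−½)` term: `Res_{s=½}ζ_{D/N} = Γ(½)^{−1}·(∓√π/4) = ∓¼`; at `s = 1`: `Res = Γ(1)^{−1}a₀/2 = ½`; `ζ_D` is regular at
every `−j` with value `(−1)ʲj!·a_{j+1}/2` (the half-integer exponents `i − ½` are never integers).

## What is proved

* §1 `hasSum_exp_neg_mul_add_half_sq` (`∑_{l≥0}e^{−t(l+½)²} = ½∑_ℤ`), **`hasSum_exp_neg_mul_natCast_mul_add_one`** (`E =
  ½e^{t/4}∑_ℤ e^{−t(n+½)²}`), `summable_exp_neg_mul_natCast_mul_add_one`, **`isBigO_tsum_exp_neg_mul_natCast_mul_add_one_sub`**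
  (`E − (√π/2)e^{t/4}t^{−1/2} = O(t^β)`, every `β`).
* §2 **`hasSum_dirichletHemisphere_multiplicity`** (`Z_D = ½(Z_{S²} − E)`), **`hasSum_neumannHemisphere_multiplicity`**
  (`Z_N = ½(Z_{S²} + E)`), `tsum_neumannHemisphere_sub_tsum_dirichletHemisphere` (`= E`).
* §3 the families `⟨l,c⟩ ↦ l(l+1)` on `Σ l, Fin l` (Dirichlet) and on `Σ l, Fin (l+1)` (Neumann): `hasSum_/summable_dirichletHemisphere`,
  `hasSum_/summable_neumannHemisphere`, `tendsto_dirichletHemisphere_cofinite_atTop`, `tendsto_neumannHemisphere_cofinite_atTop`,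
  `ncard_setOf_dirichletHemisphere_eq_zero` (`0`), `ncard_setOf_neumannHemisphere_eq_zero` (`1`).
* §4 **`isBigO_dirichletHemisphere_heatTrace_expansion`**, **`isBigO_neumannHemisphere_heatTrace_expansion`** (all orders, on
  `Fin (N+1) ⊕ Fin (N+1)`), `tsum_dirichletHemisphere_add_tsum_neumannHemisphere` (`Z_D + Z_N = Z_{S²}`),
  **`isBigO_neumannHemisphere_sub_dirichletHemisphere`** (`Z_N − Z_D − (√π/2)e^{t/4}t^{−1/2} = O(t^β)`, every `β`),
  **`isBigO_dirichletHemisphere_heatTrace_sub_mcKeanSinger`** (`Z_D = 1/(2t) − √π/(4√t) + 1/6 + O(√t)`),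
  **`isBigO_neumannHemisphere_heatTrace_sub_mcKeanSinger`** (`Z_N = 1/(2t) + √π/(4√t) + 1/6 + O(√t)`); private
  `isBigO_exp_quarter_sub_sum'`, `isBigO_E_sub_sum`, `isBigO_half_twoSphere_add_mul_E_sub`.
* §5 **`tendsto_ncard_dirichletHemisphere_le_div`**, **`tendsto_ncard_neumannHemisphere_le_div`** (WEYL `→ ½`),
  **`tendsto_dirichletHemisphereZeta_continuation_nhdsNE_zero`** (`ζ_D(0) = 1/6`),
  **`tendsto_neumannHemisphereZeta_continuation_nhdsNE_zero`** (`ζ_N(0) = −5/6`),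
  **`tendsto_sub_half_mul_dirichletHemisphereZeta_continuation`** (residue `−¼` at `s = ½`),
  **`tendsto_sub_half_mul_neumannHemisphereZeta_continuation`** (residue `+¼` at `s = ½`),
  **`exists_analyticAt_dirichletHemisphereZeta_continuation_neg_natCast`** (`ζ_D(−j) = (−1)ʲj!a_{j+1}/2`),
  **`tendsto_sub_one_mul_dirichletHemisphereZeta_continuation`** (residue `½` at `s = 1`); private exponent bookkeeping
  `hemisphereExponent_eq_iff`, `hemisphereHalfExponent_eq_iff`, `natCast_sub_half_ne_intCast/zero/neg_one/natCast`,
  `natCast_sub_one_ne_neg_half`.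

## References

* [McKeanSinger1967] H. P. McKean, I. M. Singer, *Curvature and the eigenvalues of the Laplacian*, J. Differential Geom. 1
  (1967) 43–69, eq. (6) p. 45 and §5 (2) p. 53.
* [FreitasMaoSalavessa2025] P. Freitas, J. Mao, I. Salavessa, *Pólya-type inequalities on spheres and hemispheres*, Ann. Inst.
  Fourier (2025), arXiv:2204.07277, §1.3, §2.2.
* [PathriaBeale2011] R. K. Pathria, P. D. Beale, *Statistical Mechanics*, 3rd ed. (2011), §6.5 eq. (20).
* [Berard1986] P. H. Bérard, *Spectral Geometry: Direct and Inverse Problems*, LNM 1207 (1986), Ch. V nº6 (ii), Ch. VII nº2,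
  nº10 (ii).
* [Gilkey1995] P. B. Gilkey, *Invariance theory, the heat equation, and the Atiyah–Singer index theorem*, 2nd ed. (1995),
  §1.10 Lemma 1.10.1.
* [Mulholland1928] H. P. Mulholland, Proc. Cambridge Philos. Soc. 24 (1928) 280–289.
-/

noncomputable section

open Real Filter Topology Set Asymptotics MeasureTheory

namespace Literature.Analysis.InnerProduct

/-! ### §1 The difference of the two hemisphere traces: `E(t) = ∑_{l≥0} e^{−t·l(l+1)} = ½e^{t/4}∑_{n∈ℤ}e^{−t(n+½)²} =
(√π/2)e^{t/4}t^{−1/2} + O(t^∞)` -/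

/-- `∑_{l≥0} e^{−t(l+½)²}` converges and equals `½∑_{n∈ℤ} e^{−t(n+½)²}` (the symmetry `n ↦ −1−n`). [cite: Berard1986, Ch. V
nº6 (ii) (theta series); FreitasMaoSalavessa2025, §1.3] -/
theorem hasSum_exp_neg_mul_add_half_sq {t : ℝ} (ht : 0 < t) :
    HasSum (fun l : ℕ ↦ rexp (-(t * ((l : ℝ) + 1 / 2) ^ 2)))
      (1 / 2 * ∑' n : ℤ, rexp (-(t * ((n : ℝ) + 1 / 2) ^ 2))) := by
  have hZ := summable_exp_neg_mul_intCast_add_sq (1 / 2) ht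
  have hN : Summable fun l : ℕ ↦ rexp (-(t * ((l : ℝ) + 1 / 2) ^ 2)) := by
    refine (summable_two_mul_add_one_mul_exp_neg_mul_sq ht).of_nonneg_of_le (fun _ ↦ (Real.exp_pos _).le) fun l ↦ ?_
    have : (1 : ℝ) ≤ 2 * l + 1 := by linarith [(l.cast_nonneg : (0 : ℝ) ≤ l)]
    exact le_mul_of_one_le_left (Real.exp_pos _).le this
  have h1 : HasSum (fun n : ℕ ↦ rexp (-(t * (((n : ℤ) : ℝ) + 1 / 2) ^ 2))) (∑' l : ℕ, rexp (-(t * ((l : ℝ) + 1 / 2) ^ 2))) :=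
    hN.hasSum.congr_fun fun n ↦ by push_cast; ring_nf
  have h2 : HasSum (fun n : ℕ ↦ rexp (-(t * (((-((n : ℤ) + 1) : ℤ) : ℝ) + 1 / 2) ^ 2)))
      (∑' l : ℕ, rexp (-(t * ((l : ℝ) + 1 / 2) ^ 2))) :=
    hN.hasSum.congr_fun fun n ↦ by push_cast; ring_nf
  have h := HasSum.of_nat_of_neg_add_one (f := fun n : ℤ ↦ rexp (-(t * ((n : ℝ) + 1 / 2) ^ 2))) h1 h2
  rw [h.tsum_eq]
  convert hN.hasSum using 1
  ring

/-- **`E(t) := ∑_{l≥0} e^{−t·l(l+1)} = ½e^{t/4}·∑_{n∈ℤ} e^{−t(n+½)²}`** — the difference `Z_N(t) − Z_D(t)` of the Neumann and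
Dirichlet heat traces of the hemisphere is a theta series (`l(l+1) = (l+½)² − ¼`). [cite: FreitasMaoSalavessa2025, §2.2 and §1.3
(Dirichlet multiplicity `l`, Neumann multiplicity `l+1` on `S²₊`); Berard1986, Ch. V nº6 (ii)] -/
theorem hasSum_exp_neg_mul_natCast_mul_add_one {t : ℝ} (ht : 0 < t) :
    HasSum (fun l : ℕ ↦ rexp (-(t * ((l : ℝ) * (l + 1)))))
      (rexp (t / 4) / 2 * ∑' n : ℤ, rexp (-(t * ((n : ℝ) + 1 / 2) ^ 2))) := by
  have h := (hasSum_exp_neg_mul_add_half_sq ht).mul_left (rexp (t / 4))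
  rw [← mul_assoc, mul_one_div] at h
  refine h.congr_fun fun l ↦ ?_
  rw [← Real.exp_add]
  congr 1
  ring

/-- Summability of `l ↦ e^{−t·l(l+1)}`. [cite: FreitasMaoSalavessa2025, §2.2] -/
theorem summable_exp_neg_mul_natCast_mul_add_one {t : ℝ} (ht : 0 < t) :
    Summable fun l : ℕ ↦ rexp (-(t * ((l : ℝ) * (l + 1)))) :=
  (hasSum_exp_neg_mul_natCast_mul_add_one ht).summable

/-- **`E(t) − (√π/2)e^{t/4}t^{−1/2} = O(t^β)` for EVERY `β`**: by Jacobi's transformation `∑_{n∈ℤ}e^{−t(n+½)²} =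
√(π/t)∑_k(−1)^k e^{−π²k²/t} = √(π/t) + O(t^∞)`. [cite: Berard1986, Ch. V nº6 (ii); McKeanSinger1967, eq. (6) p. 45 (the
`±¼√(4πt) × the surface area of B` boundary term)] -/
theorem isBigO_tsum_exp_neg_mul_natCast_mul_add_one_sub (β : ℝ) :
    (fun t : ℝ ↦ ∑' l : ℕ, rexp (-(t * ((l : ℝ) * (l + 1)))) -
      π ^ (1 / 2 : ℝ) / 2 * rexp (t / 4) * t ^ (-(1 / 2 : ℝ))) =O[𝓝[>] 0] fun t : ℝ ↦ t ^ β := by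
  have hE : (fun t : ℝ ↦ rexp (t / 4) / 2) =O[𝓝[>] 0] fun _ : ℝ ↦ (1 : ℝ) :=
    (((by fun_prop : Continuous fun t : ℝ ↦ rexp (t / 4) / 2).tendsto 0).isBigO_one ℝ).mono nhdsWithin_le_nhds
  have h := hE.mul (isBigO_tsum_exp_neg_mul_intCast_add_sq_sub (1 / 2) β)
  simp only [one_mul] at h
  refine h.congr' ?_ EventuallyEq.rfl
  filter_upwards [self_mem_nhdsWithin] with t (ht : 0 < t)
  rw [(hasSum_exp_neg_mul_natCast_mul_add_one ht).tsum_eq]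
  ring

/-! ### §2 The Dirichlet and Neumann hemispheres through the sphere: `Z_D = ½(Z_{S²} − E)`, `Z_N = ½(Z_{S²} + E)` -/

/-- **The Dirichlet hemisphere `S²₊`**: eigenvalues `l(l+1)`, `l ≥ 1`, with multiplicity `l` ("`λ_K = K(K+n−1)` … with
multiplicity `m(K) = C(n+K−2, n−1)`", `n = 2`); `Z_D(t) = ∑_l l·e^{−t·l(l+1)} = ½(Z_{S²}(t) − E(t))`.
[cite: FreitasMaoSalavessa2025, §2.2 (eigenvalues and multiplicities of `S^n_+`)] -/
theorem hasSum_dirichletHemisphere_multiplicity {t : ℝ} (ht : 0 < t) :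
    HasSum (fun l : ℕ ↦ (l : ℝ) * rexp (-(t * ((l : ℝ) * (l + 1)))))
      (1 / 2 * (∑' l : ℕ, (2 * (l : ℝ) + 1) * rexp (-(t * ((l : ℝ) * (l + 1)))) -
        ∑' l : ℕ, rexp (-(t * ((l : ℝ) * (l + 1)))))) := by
  have h := ((hasSum_twoSphere_multiplicity ht).summable.hasSum.sub
    (summable_exp_neg_mul_natCast_mul_add_one ht).hasSum).mul_left (1 / 2)
  exact h.congr_fun fun l ↦ by ring

/-- **The Neumann hemisphere `S²₊`**: eigenvalues `l(l+1)`, `l ≥ 0`, with multiplicity `l+1` (the spectrum of `S²` is the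
union of the Dirichlet and Neumann spectra of `S²₊`); `Z_N(t) = ∑_l (l+1)e^{−t·l(l+1)} = ½(Z_{S²}(t) + E(t))`.
[cite: FreitasMaoSalavessa2025, §1.3 ("the spectrum of `Sⁿ` consists of the union of the Dirichlet and Neumann spectra on
`Sⁿ₊`") and §2.2] -/
theorem hasSum_neumannHemisphere_multiplicity {t : ℝ} (ht : 0 < t) :
    HasSum (fun l : ℕ ↦ ((l : ℝ) + 1) * rexp (-(t * ((l : ℝ) * (l + 1)))))
      (1 / 2 * (∑' l : ℕ, (2 * (l : ℝ) + 1) * rexp (-(t * ((l : ℝ) * (l + 1)))) +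
        ∑' l : ℕ, rexp (-(t * ((l : ℝ) * (l + 1)))))) := by
  have h := ((hasSum_twoSphere_multiplicity ht).summable.hasSum.add
    (summable_exp_neg_mul_natCast_mul_add_one ht).hasSum).mul_left (1 / 2)
  exact h.congr_fun fun l ↦ by ring

/-- `Z_D + Z_N = Z_{S²}` and `Z_N − Z_D = E` at the level of sums. [cite: FreitasMaoSalavessa2025, §1.3] -/
theorem tsum_neumannHemisphere_sub_tsum_dirichletHemisphere {t : ℝ} (ht : 0 < t) :
    ∑' l : ℕ, ((l : ℝ) + 1) * rexp (-(t * ((l : ℝ) * (l + 1)))) - ∑' l : ℕ, (l : ℝ) * rexp (-(t * ((l : ℝ) * (l + 1)))) =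
      ∑' l : ℕ, rexp (-(t * ((l : ℝ) * (l + 1)))) := by
  rw [(hasSum_neumannHemisphere_multiplicity ht).tsum_eq, (hasSum_dirichletHemisphere_multiplicity ht).tsum_eq]
  ring

/-! ### §3 The two families: `⟨l, c⟩ ↦ l(l+1)` on `Σ l, Fin l` (Dirichlet) and on `Σ l, Fin (l+1)` (Neumann) -/

/-- The Dirichlet hemisphere as a family on `Σ l, Fin l`. [cite: FreitasMaoSalavessa2025, §2.2] -/
theorem hasSum_dirichletHemisphere {t : ℝ} (ht : 0 < t) :
    HasSum (fun i : (Σ l : ℕ, Fin l) ↦ rexp (-(t * ((i.1 : ℝ) * (i.1 + 1)))))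
      (1 / 2 * (∑' l : ℕ, (2 * (l : ℝ) + 1) * rexp (-(t * ((l : ℝ) * (l + 1)))) -
        ∑' l : ℕ, rexp (-(t * ((l : ℝ) * (l + 1)))))) :=
  hasSum_sigma_fin_of_hasSum_natCast_mul (d := fun l ↦ l) (f := fun l : ℕ ↦ rexp (-(t * ((l : ℝ) * (l + 1)))))
    (fun _ ↦ (Real.exp_pos _).le) (hasSum_dirichletHemisphere_multiplicity ht)

/-- The Neumann hemisphere as a family on `Σ l, Fin (l+1)`. [cite: FreitasMaoSalavessa2025, §1.3, §2.2] -/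
theorem hasSum_neumannHemisphere {t : ℝ} (ht : 0 < t) :
    HasSum (fun i : (Σ l : ℕ, Fin (l + 1)) ↦ rexp (-(t * ((i.1 : ℝ) * (i.1 + 1)))))
      (1 / 2 * (∑' l : ℕ, (2 * (l : ℝ) + 1) * rexp (-(t * ((l : ℝ) * (l + 1)))) +
        ∑' l : ℕ, rexp (-(t * ((l : ℝ) * (l + 1)))))) :=
  hasSum_sigma_fin_of_hasSum_natCast_mul (d := fun l ↦ l + 1) (f := fun l : ℕ ↦ rexp (-(t * ((l : ℝ) * (l + 1)))))
    (fun _ ↦ (Real.exp_pos _).le) ((hasSum_neumannHemisphere_multiplicity ht).congr_fun fun l ↦ by push_cast; ring)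

/-- Summability of the Dirichlet family. [cite: FreitasMaoSalavessa2025, §2.2] -/
theorem summable_dirichletHemisphere {t : ℝ} (ht : 0 < t) :
    Summable fun i : (Σ l : ℕ, Fin l) ↦ rexp (-(t * ((i.1 : ℝ) * (i.1 + 1)))) :=
  (hasSum_dirichletHemisphere ht).summable

/-- Summability of the Neumann family. [cite: FreitasMaoSalavessa2025, §1.3, §2.2] -/
theorem summable_neumannHemisphere {t : ℝ} (ht : 0 < t) :
    Summable fun i : (Σ l : ℕ, Fin (l + 1)) ↦ rexp (-(t * ((i.1 : ℝ) * (i.1 + 1)))) :=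
  (hasSum_neumannHemisphere ht).summable

/-- `l(l+1) → ∞`. [folklore] -/
private theorem tendsto_natCast_mul_add_one_atTop : Tendsto (fun l : ℕ ↦ (l : ℝ) * (l + 1)) atTop atTop :=
  tendsto_natCast_atTop_atTop.atTop_mul_atTop₀ (tendsto_natCast_atTop_atTop.atTop_add tendsto_const_nhds)

/-- The Dirichlet eigenvalues tend to `+∞` along the cofinite filter. [cite: FreitasMaoSalavessa2025, §2.2] -/
theorem tendsto_dirichletHemisphere_cofinite_atTop :
    Tendsto (fun i : (Σ l : ℕ, Fin l) ↦ (i.1 : ℝ) * (i.1 + 1)) cofinite atTop :=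
  tendsto_sigma_fin_cofinite_atTop (μ := fun l : ℕ ↦ (l : ℝ) * (l + 1)) tendsto_natCast_mul_add_one_atTop

/-- The Neumann eigenvalues tend to `+∞` along the cofinite filter. [cite: FreitasMaoSalavessa2025, §1.3, §2.2] -/
theorem tendsto_neumannHemisphere_cofinite_atTop :
    Tendsto (fun i : (Σ l : ℕ, Fin (l + 1)) ↦ (i.1 : ℝ) * (i.1 + 1)) cofinite atTop :=
  tendsto_sigma_fin_cofinite_atTop (μ := fun l : ℕ ↦ (l : ℝ) * (l + 1)) tendsto_natCast_mul_add_one_atTop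

/-- `l(l+1) = 0 ↔ l = 0` on `ℕ`. [folklore] -/
private theorem natCast_mul_add_one_eq_zero_iff (l : ℕ) : (l : ℝ) * (l + 1) = 0 ↔ l = 0 := by
  constructor
  · intro h
    rcases mul_eq_zero.mp h with h | h
    · exact_mod_cast h
    · have : (0 : ℝ) < l + 1 := by positivity
      linarith
  · rintro rfl; simp

/-- The Dirichlet hemisphere has NO zero mode (`Fin 0` is empty). [cite: FreitasMaoSalavessa2025, §2.2 (`K ≥ 1`)] -/
theorem ncard_setOf_dirichletHemisphere_eq_zero :
    {i : (Σ l : ℕ, Fin l) | (i.1 : ℝ) * (i.1 + 1) = 0}.ncard = 0 := by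
  rw [ncard_setOf_sigma_fin_eq (d := fun l ↦ l) (μ := fun l : ℕ ↦ (l : ℝ) * (l + 1)) natCast_mul_add_one_eq_zero_iff]

/-- The Neumann hemisphere has exactly one zero mode (the constants). [cite: FreitasMaoSalavessa2025, §1.3] -/
theorem ncard_setOf_neumannHemisphere_eq_zero :
    {i : (Σ l : ℕ, Fin (l + 1)) | (i.1 : ℝ) * (i.1 + 1) = 0}.ncard = 1 := by
  rw [ncard_setOf_sigma_fin_eq (d := fun l ↦ l + 1) (μ := fun l : ℕ ↦ (l : ℝ) * (l + 1)) natCast_mul_add_one_eq_zero_iff]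

/-! ### §4 The expansions: integer powers from `½Z_{S²}`, half-integer powers from `∓½E` — McKean–Singer's formula (6) on `S²₊` -/

/-- `e^{t/4} − ∑_{i≤M} (t/4)^i/i! = O(t^{M+1})` at `0⁺`. [folklore] -/
private theorem isBigO_exp_quarter_sub_sum' (M : ℕ) :
    (fun t : ℝ ↦ rexp (t / 4) - ∑ i ∈ Finset.range (M + 1), (1 / 4 : ℝ) ^ i / (i.factorial : ℝ) * t ^ i) =O[𝓝[>] 0]
      fun t : ℝ ↦ t ^ (M + 1) := by
  refine IsBigO.of_bound (((M + 1).succ : ℝ) / (((M + 1).factorial : ℝ) * ((M + 1 : ℕ) : ℝ))) ?_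
  filter_upwards [Ioc_mem_nhdsGT (zero_lt_one' ℝ)] with t ht
  have hb := Real.exp_bound (x := t / 4) (by rw [abs_of_pos (by linarith [ht.1])]; linarith [ht.2]) (Nat.succ_pos M)
  have e : ∑ i ∈ Finset.range (M + 1), (1 / 4 : ℝ) ^ i / (i.factorial : ℝ) * t ^ i =
      ∑ i ∈ Finset.range (M + 1), (t / 4) ^ i / (i.factorial : ℝ) :=
    Finset.sum_congr rfl fun i _ ↦ by rw [div_pow, div_pow, one_pow]; ring
  rw [Real.norm_eq_abs, Real.norm_of_nonneg (pow_nonneg ht.1.le _), e]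
  refine hb.trans ?_
  rw [abs_of_pos (by linarith [ht.1]), div_pow]
  have h4 : t ^ (M + 1) / 4 ^ (M + 1) ≤ t ^ (M + 1) := div_le_self (pow_nonneg ht.1.le _)
    (one_le_pow₀ (by norm_num))
  have hc : (0 : ℝ) ≤ ((M + 1).succ : ℝ) / (((M + 1).factorial : ℝ) * ((M + 1 : ℕ) : ℝ)) := by positivity
  calc t ^ M.succ / 4 ^ M.succ * ((M.succ.succ : ℝ) / ((M.succ.factorial : ℝ) * (M.succ : ℝ)))
      = ((M + 1).succ : ℝ) / (((M + 1).factorial : ℝ) * ((M + 1 : ℕ) : ℝ)) * (t ^ (M + 1) / 4 ^ (M + 1)) := by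
        rw [mul_comm]
    _ ≤ _ := mul_le_mul_of_nonneg_left h4 hc

/-- The half-integer part: `E(t) − (√π/2)∑_{i≤N}((1/4)^i/i!)t^{i−1/2} = O(t^N)`. [cite: McKeanSinger1967, eq. (6) p. 45;
Berard1986, Ch. V nº6 (ii)] -/
private theorem isBigO_E_sub_sum (N : ℕ) :
    (fun t : ℝ ↦ (∑' l : ℕ, rexp (-(t * ((l : ℝ) * (l + 1))))) -
      π ^ (1 / 2 : ℝ) / 2 * ∑ i : Fin (N + 1), (1 / 4 : ℝ) ^ (i : ℕ) / ((i : ℕ).factorial : ℝ) * t ^ (((i : ℕ) : ℝ) - 1 / 2))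
      =O[𝓝[>] 0] fun t : ℝ ↦ t ^ (N : ℝ) := by
  have h1 := isBigO_tsum_exp_neg_mul_natCast_mul_add_one_sub (N : ℝ)
  -- `t^{−1/2}(e^{t/4} − P_N(t)) = O(t^{N + 1/2}) = O(t^N)`
  have h2 : (fun t : ℝ ↦ π ^ (1 / 2 : ℝ) / 2 * t ^ (-(1 / 2 : ℝ)) *
      (rexp (t / 4) - ∑ i ∈ Finset.range (N + 1), (1 / 4 : ℝ) ^ i / (i.factorial : ℝ) * t ^ i)) =O[𝓝[>] 0]
      fun t : ℝ ↦ t ^ (N : ℝ) := by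
    have h := ((isBigO_refl (fun t : ℝ ↦ π ^ (1 / 2 : ℝ) / 2 * t ^ (-(1 / 2 : ℝ))) (𝓝[>] (0:ℝ))).mul
      (isBigO_exp_quarter_sub_sum' N))
    refine h.trans ?_
    refine IsBigO.of_bound (π ^ (1 / 2 : ℝ) / 2) ?_
    filter_upwards [Ioc_mem_nhdsGT (zero_lt_one' ℝ)] with t ht
    have ht0 : 0 < t := ht.1
    rw [Real.norm_of_nonneg (by positivity), Real.norm_of_nonneg (by positivity), mul_assoc]
    refine mul_le_mul_of_nonneg_left ?_ (by positivity)
    rw [show ((N : ℝ)) = -(1 / 2 : ℝ) + ((N : ℝ) + 1 / 2) by ring, Real.rpow_add ht0, ← Real.rpow_natCast,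
      show (((N + 1 : ℕ)) : ℝ) = ((N : ℝ) + 1 / 2) + 1 / 2 by push_cast; ring, Real.rpow_add ht0 ((N : ℝ) + 1 / 2)]
    refine mul_le_mul_of_nonneg_left ?_ (by positivity)
    refine mul_le_of_le_one_right (by positivity) ?_
    exact Real.rpow_le_one ht0.le ht.2 (by norm_num)
  have h := h1.add h2
  refine h.congr' ?_ EventuallyEq.rfl
  filter_upwards [self_mem_nhdsWithin] with t (ht : 0 < t)
  rw [Finset.mul_sum, ← Fin.sum_univ_eq_sum_range (fun i : ℕ ↦
    (1 / 4 : ℝ) ^ i / (i.factorial : ℝ) * t ^ i) (N + 1), mul_sub, Finset.mul_sum]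
  have e : ∀ i : Fin (N + 1), π ^ (1 / 2 : ℝ) / 2 * ((1 / 4 : ℝ) ^ (i : ℕ) / ((i : ℕ).factorial : ℝ) *
      t ^ (((i : ℕ) : ℝ) - 1 / 2)) =
      π ^ (1 / 2 : ℝ) / 2 * t ^ (-(1 / 2 : ℝ)) * ((1 / 4 : ℝ) ^ (i : ℕ) / ((i : ℕ).factorial : ℝ) * t ^ (i : ℕ)) := by
    intro i
    rw [show ((i : ℕ) : ℝ) - 1 / 2 = ((i : ℕ) : ℝ) + -(1 / 2 : ℝ) by ring, Real.rpow_add ht, Real.rpow_natCast]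
    ring
  simp only [e]
  ring

/-- The common core of both expansions: `½(Z_{S²}(t) + εE(t)) − [∑_k (a_k/2)t^{k−1} + ε(√π/4)∑_i((1/4)^i/i!)t^{i−1/2}]
= O(t^N)` for every real `ε`. [cite: McKeanSinger1967, eq. (6) p. 45; PathriaBeale2011, §6.5 eq. (20)] -/
private theorem isBigO_half_twoSphere_add_mul_E_sub (ε : ℝ) (N : ℕ) :
    (fun t : ℝ ↦ 1 / 2 * ((∑' l : ℕ, (2 * (l : ℝ) + 1) * rexp (-(t * ((l : ℝ) * (l + 1))))) + ε * (∑' l : ℕ, rexp (-(t * ((l : ℝ) * (l + 1)))))) -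
      ∑ k : Fin (N + 1) ⊕ Fin (N + 1), Sum.elim (fun k : Fin (N + 1) ↦ (∑ p ∈ Finset.HasAntidiagonal.antidiagonal (k : ℕ),
          (1 / 4 : ℝ) ^ p.1 / (p.1.factorial : ℝ) * ((-1 : ℝ) ^ p.2 * (2 / 4 ^ p.2 - 1) * (bernoulli (2 * p.2) : ℝ) /
            (p.2.factorial : ℝ))) / 2)
          (fun i : Fin (N + 1) ↦ ε * (π ^ (1 / 2 : ℝ) / 4) * ((1 / 4 : ℝ) ^ (i : ℕ) / ((i : ℕ).factorial : ℝ))) k * t ^ (Sum.elim (fun k : Fin (N + 1) ↦ ((k : ℕ) : ℝ) - 1) (fun i : Fin (N + 1) ↦ ((i : ℕ) : ℝ) - 1 / 2) k)) =O[𝓝[>] 0] fun t : ℝ ↦ t ^ (N : ℝ) := by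
  have hS := isBigO_twoSphere_heatTrace_expansion N
  have hE := isBigO_E_sub_sum N
  have h := (hS.const_mul_left (1 / 2)).add (hE.const_mul_left (ε / 2))
  refine h.congr' ?_ EventuallyEq.rfl
  filter_upwards [self_mem_nhdsWithin] with t (ht : 0 < t)
  rw [(hasSum_twoSphere ht).tsum_eq, Fintype.sum_sum_type]
  simp only [Sum.elim_inl, Sum.elim_inr]
  rw [Finset.mul_sum (a := π ^ (1 / 2 : ℝ) / 2)]
  have e1 : ∀ k : Fin (N + 1), (∑ p ∈ Finset.HasAntidiagonal.antidiagonal (k : ℕ),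
          (1 / 4 : ℝ) ^ p.1 / (p.1.factorial : ℝ) * ((-1 : ℝ) ^ p.2 * (2 / 4 ^ p.2 - 1) * (bernoulli (2 * p.2) : ℝ) /
            (p.2.factorial : ℝ))) / 2 * t ^ (((k : ℕ) : ℝ) - 1) = 1 / 2 * ((∑ p ∈ Finset.HasAntidiagonal.antidiagonal (k : ℕ),
          (1 / 4 : ℝ) ^ p.1 / (p.1.factorial : ℝ) * ((-1 : ℝ) ^ p.2 * (2 / 4 ^ p.2 - 1) * (bernoulli (2 * p.2) : ℝ) /
            (p.2.factorial : ℝ))) * t ^ (((k : ℕ) : ℝ) - 1)) := fun k ↦ by ring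
  have e2 : ∀ i : Fin (N + 1), ε * (π ^ (1 / 2 : ℝ) / 4) * ((1 / 4 : ℝ) ^ (i : ℕ) / ((i : ℕ).factorial : ℝ)) *
      t ^ (((i : ℕ) : ℝ) - 1 / 2) = ε / 2 * (π ^ (1 / 2 : ℝ) / 2 * ((1 / 4 : ℝ) ^ (i : ℕ) / ((i : ℕ).factorial : ℝ) *
      t ^ (((i : ℕ) : ℝ) - 1 / 2))) := fun i ↦ by ring
  simp only [e1, e2, ← Finset.mul_sum]
  ring

/-- **THE DIRICHLET HEMISPHERE TO ALL ORDERS: `Z_D(t) − [∑_{k≤N}(a_k/2)t^{k−1} − (√π/4)∑_{i≤N}((1/4)^i/i!)t^{i−1/2}] = O(t^N)`**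
(`a_k` the Mulholland coefficients of `S²`; index set `Fin (N+1) ⊕ Fin (N+1)` for the integer and the half-integer powers):
McKean–Singer's "(6) `(4πt)^{d/2}Z± = the volume of D ± ¼√(4πt) × the surface area of B + (t/3) × ∫_D K − (t/6) × ∫_B J +
O(t^{3/2})`" (`Z⁻` = Dirichlet) with `vol D = area B = 2π`,
`K ≡ 1`, `J ≡ 0` (the equator is a geodesic), continued to all orders: `Z_D = 1/(2t) − √π/(4√t) + 1/6 − (√π/16)√t + t/30 − ⋯`.
[cite: McKeanSinger1967, eq. (6) p. 45; FreitasMaoSalavessa2025, §2.2; PathriaBeale2011, §6.5 eq. (20)] -/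
theorem isBigO_dirichletHemisphere_heatTrace_expansion (N : ℕ) :
    (fun t : ℝ ↦ ∑' i : (Σ l : ℕ, Fin l), rexp (-(t * ((i.1 : ℝ) * (i.1 + 1)))) -
      ∑ k : Fin (N + 1) ⊕ Fin (N + 1), Sum.elim (fun k : Fin (N + 1) ↦ (∑ p ∈ Finset.HasAntidiagonal.antidiagonal (k : ℕ),
          (1 / 4 : ℝ) ^ p.1 / (p.1.factorial : ℝ) * ((-1 : ℝ) ^ p.2 * (2 / 4 ^ p.2 - 1) * (bernoulli (2 * p.2) : ℝ) /
            (p.2.factorial : ℝ))) / 2)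
          (fun i : Fin (N + 1) ↦ (-1) * (π ^ (1 / 2 : ℝ) / 4) * ((1 / 4 : ℝ) ^ (i : ℕ) / ((i : ℕ).factorial : ℝ))) k * t ^ (Sum.elim (fun k : Fin (N + 1) ↦ ((k : ℕ) : ℝ) - 1) (fun i : Fin (N + 1) ↦ ((i : ℕ) : ℝ) - 1 / 2) k)) =O[𝓝[>] 0] fun t : ℝ ↦ t ^ (N : ℝ) := by
  refine (isBigO_half_twoSphere_add_mul_E_sub (-1) N).congr' ?_ EventuallyEq.rfl
  filter_upwards [self_mem_nhdsWithin] with t (ht : 0 < t)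
  rw [(hasSum_dirichletHemisphere ht).tsum_eq]
  ring

/-- **THE NEUMANN HEMISPHERE TO ALL ORDERS: `Z_N(t) − [∑_{k≤N}(a_k/2)t^{k−1} + (√π/4)∑_{i≤N}((1/4)^i/i!)t^{i−1/2}] = O(t^N)`**
(McKean–Singer's (6) with the upper sign, `Z⁺` = Neumann): `Z_N = 1/(2t) + √π/(4√t) + 1/6 +
(√π/16)√t + t/30 + ⋯`. [cite: McKeanSinger1967, eq. (6) p. 45; FreitasMaoSalavessa2025, §1.3; PathriaBeale2011, §6.5 eq. (20)] -/
theorem isBigO_neumannHemisphere_heatTrace_expansion (N : ℕ) :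
    (fun t : ℝ ↦ ∑' i : (Σ l : ℕ, Fin (l + 1)), rexp (-(t * ((i.1 : ℝ) * (i.1 + 1)))) -
      ∑ k : Fin (N + 1) ⊕ Fin (N + 1), Sum.elim (fun k : Fin (N + 1) ↦ (∑ p ∈ Finset.HasAntidiagonal.antidiagonal (k : ℕ),
          (1 / 4 : ℝ) ^ p.1 / (p.1.factorial : ℝ) * ((-1 : ℝ) ^ p.2 * (2 / 4 ^ p.2 - 1) * (bernoulli (2 * p.2) : ℝ) /
            (p.2.factorial : ℝ))) / 2)
          (fun i : Fin (N + 1) ↦ 1 * (π ^ (1 / 2 : ℝ) / 4) * ((1 / 4 : ℝ) ^ (i : ℕ) / ((i : ℕ).factorial : ℝ))) k * t ^ (Sum.elim (fun k : Fin (N + 1) ↦ ((k : ℕ) : ℝ) - 1) (fun i : Fin (N + 1) ↦ ((i : ℕ) : ℝ) - 1 / 2) k)) =O[𝓝[>] 0] fun t : ℝ ↦ t ^ (N : ℝ) := by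
  refine (isBigO_half_twoSphere_add_mul_E_sub 1 N).congr' ?_ EventuallyEq.rfl
  filter_upwards [self_mem_nhdsWithin] with t (ht : 0 < t)
  rw [(hasSum_neumannHemisphere ht).tsum_eq]
  ring

/-- **`Z_D(t) + Z_N(t) = Z_{S²}(t)`**: the Dirichlet and Neumann spectra of the hemisphere together make up the spectrum of the
sphere. [cite: FreitasMaoSalavessa2025, §1.3] -/
theorem tsum_dirichletHemisphere_add_tsum_neumannHemisphere {t : ℝ} (ht : 0 < t) :
    ∑' i : (Σ l : ℕ, Fin l), rexp (-(t * ((i.1 : ℝ) * (i.1 + 1)))) + ∑' i : (Σ l : ℕ, Fin (l + 1)), rexp (-(t * ((i.1 : ℝ) * (i.1 + 1)))) =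
      ∑' i : (Σ l : ℕ, Fin (2 * l + 1)), rexp (-(t * ((i.1 : ℝ) * (i.1 + 1)))) := by
  rw [(hasSum_dirichletHemisphere ht).tsum_eq, (hasSum_neumannHemisphere ht).tsum_eq, (hasSum_twoSphere ht).tsum_eq]
  ring

/-- **`Z_N(t) − Z_D(t) − (√π/2)e^{t/4}t^{−1/2} = O(t^β)` for EVERY `β`** — the boundary contributions of the two problems
are exactly opposite and, up to `O(t^∞)`, a closed form. [cite: McKeanSinger1967, eq. (6) p. 45 (the `±¼√(4πt) × area B` term);
Berard1986, Ch. V nº6 (ii)] -/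
theorem isBigO_neumannHemisphere_sub_dirichletHemisphere (β : ℝ) :
    (fun t : ℝ ↦ ∑' i : (Σ l : ℕ, Fin (l + 1)), rexp (-(t * ((i.1 : ℝ) * (i.1 + 1)))) - ∑' i : (Σ l : ℕ, Fin l), rexp (-(t * ((i.1 : ℝ) * (i.1 + 1)))) -
      π ^ (1 / 2 : ℝ) / 2 * rexp (t / 4) * t ^ (-(1 / 2 : ℝ))) =O[𝓝[>] 0] fun t : ℝ ↦ t ^ β := by
  refine (isBigO_tsum_exp_neg_mul_natCast_mul_add_one_sub β).congr' ?_ EventuallyEq.rfl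
  filter_upwards [self_mem_nhdsWithin] with t (ht : 0 < t)
  rw [(hasSum_dirichletHemisphere ht).tsum_eq, (hasSum_neumannHemisphere ht).tsum_eq]
  ring

/-- **McKEAN–SINGER (6) FOR THE DIRICHLET HEMISPHERE, AS PRINTED: `Z_D(t) = 1/(2t) − √π/(4√t) + 1/6 + O(√t)`** (`(4πt)Z⁻ =
2π − ¼√(4πt)·2π + (t/3)·2π − 0 + O(t^{3/2})`). [cite: McKeanSinger1967, eq. (6) p. 45; FreitasMaoSalavessa2025, §2.2] -/
theorem isBigO_dirichletHemisphere_heatTrace_sub_mcKeanSinger :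
    (fun t : ℝ ↦ ∑' i : (Σ l : ℕ, Fin l), rexp (-(t * ((i.1 : ℝ) * (i.1 + 1)))) -
      (1 / (2 * t) - π ^ (1 / 2 : ℝ) / 4 * t ^ (-(1 / 2 : ℝ)) + 1 / 6)) =O[𝓝[>] 0] fun t : ℝ ↦ t ^ (1 / 2 : ℝ) := by
  have h := isBigO_dirichletHemisphere_heatTrace_expansion 1
  -- the `N = 1` expansion has the extra term `−(√π/16)t^{1/2}`, itself `O(t^{1/2})`
  have h1 : (fun t : ℝ ↦ t ^ ((1 : ℕ) : ℝ)) =O[𝓝[>] 0] fun t : ℝ ↦ t ^ (1 / 2 : ℝ) := by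
    refine IsBigO.of_bound 1 ?_
    filter_upwards [Ioc_mem_nhdsGT (zero_lt_one' ℝ)] with t ht
    rw [Real.norm_of_nonneg (Real.rpow_nonneg ht.1.le _), Real.norm_of_nonneg (Real.rpow_nonneg ht.1.le _), one_mul,
      Nat.cast_one]
    exact Real.rpow_le_rpow_of_exponent_ge ht.1 ht.2 (by norm_num)
  have h2 : (fun t : ℝ ↦ -(π ^ (1 / 2 : ℝ) / 4) * ((1 / 4 : ℝ) / 1) * t ^ (1 / 2 : ℝ)) =O[𝓝[>] 0]
      fun t : ℝ ↦ t ^ (1 / 2 : ℝ) := (isBigO_refl _ _).const_mul_left _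
  refine ((h.trans h1).add h2).congr' ?_ EventuallyEq.rfl
  filter_upwards [self_mem_nhdsWithin] with t (ht : 0 < t)
  rw [Fintype.sum_sum_type, Fin.sum_univ_two, Fin.sum_univ_two]
  simp only [Sum.elim_inl, Sum.elim_inr, Fin.val_zero, Fin.val_one, Nat.cast_zero, Nat.cast_one, pow_zero, pow_one,
    Nat.factorial_zero, Nat.factorial_one, twoSphere_heatCoeff_zero, twoSphere_heatCoeff_one, zero_sub, sub_self,
    Real.rpow_zero, Real.rpow_neg_one]
  field_simp
  ring

/-- **McKEAN–SINGER (6) FOR THE NEUMANN HEMISPHERE, AS PRINTED: `Z_N(t) = 1/(2t) + √π/(4√t) + 1/6 + O(√t)`**.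
[cite: McKeanSinger1967, eq. (6) p. 45; FreitasMaoSalavessa2025, §1.3] -/
theorem isBigO_neumannHemisphere_heatTrace_sub_mcKeanSinger :
    (fun t : ℝ ↦ ∑' i : (Σ l : ℕ, Fin (l + 1)), rexp (-(t * ((i.1 : ℝ) * (i.1 + 1)))) -
      (1 / (2 * t) + π ^ (1 / 2 : ℝ) / 4 * t ^ (-(1 / 2 : ℝ)) + 1 / 6)) =O[𝓝[>] 0] fun t : ℝ ↦ t ^ (1 / 2 : ℝ) := by
  have h := isBigO_neumannHemisphere_heatTrace_expansion 1
  have h1 : (fun t : ℝ ↦ t ^ ((1 : ℕ) : ℝ)) =O[𝓝[>] 0] fun t : ℝ ↦ t ^ (1 / 2 : ℝ) := by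
    refine IsBigO.of_bound 1 ?_
    filter_upwards [Ioc_mem_nhdsGT (zero_lt_one' ℝ)] with t ht
    rw [Real.norm_of_nonneg (Real.rpow_nonneg ht.1.le _), Real.norm_of_nonneg (Real.rpow_nonneg ht.1.le _), one_mul,
      Nat.cast_one]
    exact Real.rpow_le_rpow_of_exponent_ge ht.1 ht.2 (by norm_num)
  have h2 : (fun t : ℝ ↦ (π ^ (1 / 2 : ℝ) / 4) * ((1 / 4 : ℝ) / 1) * t ^ (1 / 2 : ℝ)) =O[𝓝[>] 0]
      fun t : ℝ ↦ t ^ (1 / 2 : ℝ) := (isBigO_refl _ _).const_mul_left _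
  refine ((h.trans h1).add h2).congr' ?_ EventuallyEq.rfl
  filter_upwards [self_mem_nhdsWithin] with t (ht : 0 < t)
  rw [Fintype.sum_sum_type, Fin.sum_univ_two, Fin.sum_univ_two]
  simp only [Sum.elim_inl, Sum.elim_inr, Fin.val_zero, Fin.val_one, Nat.cast_zero, Nat.cast_one, pow_zero, pow_one,
    Nat.factorial_zero, Nat.factorial_one, twoSphere_heatCoeff_zero, twoSphere_heatCoeff_one, zero_sub, sub_self,
    Real.rpow_zero, Real.rpow_neg_one]
  field_simp
  ring

/-! ### §5 Consequences through the abstract heat-trace theory: Weyl `#{λ ≤ Λ} ∼ Λ/2` for both problems, `ζ_D(0) = 1/6`,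
`ζ_N(0) = −5/6`, the half-integer pole `s = ½` with residues `∓1/4`, the pole `s = 1` with residue `½` -/

/-- `Fin (N+1)`-indexed exponent bookkeeping for the integer powers: `k − 1 = x ↔ k = ⟨m, _⟩` when `x + 1 = m`. [folklore] -/
private theorem hemisphereExponent_eq_iff (N : ℕ) {m : ℕ} (hm : m < N + 1) (x : ℝ) (hx : x + 1 = m) (k : Fin (N + 1)) :
    ((((k : ℕ) : ℝ) - 1) = x) = (k = ⟨m, hm⟩) := by
  rw [Fin.ext_iff, sub_eq_iff_eq_add, hx]
  simp only [Nat.cast_inj]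

/-- … and for the half-integer powers: `i − ½ = x ↔ i = ⟨m, _⟩` when `x + ½ = m`. [folklore] -/
private theorem hemisphereHalfExponent_eq_iff (N : ℕ) {m : ℕ} (hm : m < N + 1) (x : ℝ) (hx : x + 1 / 2 = m)
    (i : Fin (N + 1)) : ((((i : ℕ) : ℝ) - 1 / 2) = x) = (i = ⟨m, hm⟩) := by
  rw [Fin.ext_iff, sub_eq_iff_eq_add, hx]
  simp only [Nat.cast_inj]

/-- A half-integer exponent is never an integer: `i − ½ ≠ m`. [folklore] -/
private theorem natCast_sub_half_ne_intCast (i : ℕ) (m : ℤ) : (i : ℝ) - 1 / 2 ≠ (m : ℝ) := by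
  intro h
  have h2 : ((2 * (i : ℤ) - 1 : ℤ) : ℝ) = ((2 * m : ℤ) : ℝ) := by push_cast; linarith
  have h3 := Int.cast_injective h2
  omega

/-- `i − ½ ≠ 0`. [folklore] -/
private theorem natCast_sub_half_ne_zero (i : ℕ) : (i : ℝ) - 1 / 2 ≠ 0 := by
  simpa using natCast_sub_half_ne_intCast i 0

/-- `i − ½ ≠ −1`. [folklore] -/
private theorem natCast_sub_half_ne_neg_one (i : ℕ) : (i : ℝ) - 1 / 2 ≠ -1 := by
  simpa using natCast_sub_half_ne_intCast i (-1)

/-- `i − ½ ≠ j`. [folklore] -/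
private theorem natCast_sub_half_ne_natCast (i j : ℕ) : (i : ℝ) - 1 / 2 ≠ (j : ℝ) := by
  simpa using natCast_sub_half_ne_intCast i j

/-- `k − 1 ≠ −½`. [folklore] -/
private theorem natCast_sub_one_ne_neg_half (k : ℕ) : (k : ℝ) - 1 ≠ -(1 / 2) := by
  intro h
  exact natCast_sub_half_ne_intCast k 0 (by push_cast; linarith)

/-- **WEYL'S LAW FOR THE DIRICHLET HEMISPHERE: `#{λ ≤ Λ}/Λ → ½ = Area(S²₊)/(4π)`** — the boundary term `∓√π/(4√t)` is
invisible at Weyl order. [cite: Berard1986, Ch. VII nº10 (ii) (11); McKeanSinger1967, eq. (6) p. 45; FreitasMaoSalavessa2025,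
§2.2] -/
theorem tendsto_ncard_dirichletHemisphere_le_div :
    Tendsto (fun Λ : ℝ ↦ (({i : (Σ l : ℕ, Fin l) | ((i.1 : ℝ) * (i.1 + 1)) ≤ Λ}.ncard : ℕ) : ℝ) / Λ) atTop (𝓝 (1 / 2)) := by
  have hexp : (fun t : ℝ ↦ ∑' i : (Σ l : ℕ, Fin l), rexp (-(((i.1 : ℝ) * (i.1 + 1)) * t)) -
      ∑ k : Fin (0 + 1) ⊕ Fin (0 + 1), Sum.elim (fun k : Fin (0 + 1) ↦ (∑ p ∈ Finset.HasAntidiagonal.antidiagonal (k : ℕ),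
          (1 / 4 : ℝ) ^ p.1 / (p.1.factorial : ℝ) * ((-1 : ℝ) ^ p.2 * (2 / 4 ^ p.2 - 1) * (bernoulli (2 * p.2) : ℝ) /
            (p.2.factorial : ℝ))) / 2)
          (fun i : Fin (0 + 1) ↦ (-1) * (π ^ (1 / 2 : ℝ) / 4) * ((1 / 4 : ℝ) ^ (i : ℕ) / ((i : ℕ).factorial : ℝ))) k *
        t ^ (Sum.elim (fun k : Fin (0 + 1) ↦ ((k : ℕ) : ℝ) - 1) (fun i : Fin (0 + 1) ↦ ((i : ℕ) : ℝ) - 1 / 2) k)) =O[𝓝[>] 0] fun t : ℝ ↦ t ^ (((0 : ℕ) : ℝ)) := by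
    refine ((isBigO_dirichletHemisphere_heatTrace_expansion 0).congr' ?_ EventuallyEq.rfl)
    filter_upwards with t
    congr 1
    exact tsum_congr fun i ↦ by rw [mul_comm]
  have hsum : ∀ t : ℝ, 0 < t → Summable fun i : (Σ l : ℕ, Fin l) ↦ rexp (-(((i.1 : ℝ) * (i.1 + 1)) * t)) :=
    fun t ht ↦ (summable_dirichletHemisphere ht).congr fun i ↦ by rw [mul_comm]
  have h := tendsto_ncard_le_div_rpow_of_expansion (μ := fun i : (Σ l : ℕ, Fin l) ↦ ((i.1 : ℝ) * (i.1 + 1))) (ρ := (1 : ℝ))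
    (fun i ↦ by positivity) hsum hexp (fun k ↦ ?_) (by simp) (by norm_num)
  swap
  · rcases k with k | i
    · simp
    · simp only [Sum.elim_inr]
      linarith [((i : ℕ).cast_nonneg : (0 : ℝ) ≤ (i : ℕ))]
  have h0 : 0 < 0 + 1 := Nat.succ_pos 0
  have e : (∑ k : Fin (0 + 1) ⊕ Fin (0 + 1), if Sum.elim (fun k : Fin (0 + 1) ↦ ((k : ℕ) : ℝ) - 1) (fun i : Fin (0 + 1) ↦ ((i : ℕ) : ℝ) - 1 / 2) k = -(1 : ℝ) then
      Sum.elim (fun k : Fin (0 + 1) ↦ (∑ p ∈ Finset.HasAntidiagonal.antidiagonal (k : ℕ),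
          (1 / 4 : ℝ) ^ p.1 / (p.1.factorial : ℝ) * ((-1 : ℝ) ^ p.2 * (2 / 4 ^ p.2 - 1) * (bernoulli (2 * p.2) : ℝ) /
            (p.2.factorial : ℝ))) / 2)
          (fun i : Fin (0 + 1) ↦ (-1) * (π ^ (1 / 2 : ℝ) / 4) * ((1 / 4 : ℝ) ^ (i : ℕ) / ((i : ℕ).factorial : ℝ))) k else 0) / Real.Gamma ((1 : ℝ) + 1) = 1 / 2 := by
    rw [show (1 : ℝ) + 1 = 2 by norm_num, Real.Gamma_two, Fintype.sum_sum_type]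
    simp only [Sum.elim_inl, Sum.elim_inr, hemisphereExponent_eq_iff 0 h0 (-1) (by norm_num), Finset.sum_ite_eq',
      Finset.mem_univ, if_true, natCast_sub_half_ne_neg_one, if_false, Finset.sum_const_zero, add_zero,
      twoSphere_heatCoeff_zero, div_one]
  rw [e] at h
  refine h.congr' ?_
  filter_upwards with Λ
  rw [Real.rpow_one]

/-- **`ζ_D(0) = a₁ᴰ − dim ker Δ_D = 1/6 − 0 = 1/6`** — only the INTEGER powers of the expansion contribute at `s = 0`, and `t⁰` carries `a₁/2 = 1/6`
(half of `χ(S²)/6 = 1/3`); the boundary terms sit at half-integer exponents. [cite: Gilkey1995, §1.10 Lemma 1.10.1;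
McKeanSinger1967, eq. (6) p. 45; FreitasMaoSalavessa2025, §2.2] -/
theorem tendsto_dirichletHemisphereZeta_continuation_nhdsNE_zero (N : ℕ) (hN : N ≠ 0) :
    Tendsto (fun s : ℂ ↦ (Complex.Gamma s)⁻¹ *
        (∑ k : Fin (N + 1) ⊕ Fin (N + 1), (((Sum.elim (fun k : Fin (N + 1) ↦ (∑ p ∈ Finset.HasAntidiagonal.antidiagonal (k : ℕ),
          (1 / 4 : ℝ) ^ p.1 / (p.1.factorial : ℝ) * ((-1 : ℝ) ^ p.2 * (2 / 4 ^ p.2 - 1) * (bernoulli (2 * p.2) : ℝ) /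
            (p.2.factorial : ℝ))) / 2)
          (fun i : Fin (N + 1) ↦ (-1) * (π ^ (1 / 2 : ℝ) / 4) * ((1 / 4 : ℝ) ^ (i : ℕ) / ((i : ℕ).factorial : ℝ))) k : ℝ)) : ℂ) / (s + ((Sum.elim (fun k : Fin (N + 1) ↦ ((k : ℕ) : ℝ) - 1) (fun i : Fin (N + 1) ↦ ((i : ℕ) : ℝ) - 1 / 2) k) : ℝ)) -
          ({i : (Σ l : ℕ, Fin l) | ((i.1 : ℝ) * (i.1 + 1)) = 0}.ncard : ℂ) / s +
        mellin (fun t : ℝ ↦ ((∑' i : {i : (Σ l : ℕ, Fin l) | ((i.1 : ℝ) * (i.1 + 1)) ≠ 0},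
            rexp (-(t * ((((i : (Σ l : ℕ, Fin l))).1 : ℝ) * (((i : (Σ l : ℕ, Fin l))).1 + 1)))) : ℝ) : ℂ) -
          (Ioc 0 1).indicator (fun t : ℝ ↦ ((∑ k : Fin (N + 1) ⊕ Fin (N + 1), Sum.elim (fun k : Fin (N + 1) ↦ (∑ p ∈ Finset.HasAntidiagonal.antidiagonal (k : ℕ),
          (1 / 4 : ℝ) ^ p.1 / (p.1.factorial : ℝ) * ((-1 : ℝ) ^ p.2 * (2 / 4 ^ p.2 - 1) * (bernoulli (2 * p.2) : ℝ) /
            (p.2.factorial : ℝ))) / 2)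
          (fun i : Fin (N + 1) ↦ (-1) * (π ^ (1 / 2 : ℝ) / 4) * ((1 / 4 : ℝ) ^ (i : ℕ) / ((i : ℕ).factorial : ℝ))) k *
            t ^ (Sum.elim (fun k : Fin (N + 1) ↦ ((k : ℕ) : ℝ) - 1) (fun i : Fin (N + 1) ↦ ((i : ℕ) : ℝ) - 1 / 2) k) : ℝ) : ℂ) -
            ({i : (Σ l : ℕ, Fin l) | ((i.1 : ℝ) * (i.1 + 1)) = 0}.ncard : ℂ)) t) s))
      (𝓝[≠] 0) (𝓝 (1 / 6)) := by
  have hβ : (0 : ℝ) < (N : ℝ) := by exact_mod_cast Nat.pos_of_ne_zero hN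
  have h := tendsto_continuation_nhdsNE_zero (μ := fun i : (Σ l : ℕ, Fin l) ↦ ((i.1 : ℝ) * (i.1 + 1)))
    (fun i ↦ by positivity) tendsto_dirichletHemisphere_cofinite_atTop (fun t ht ↦ summable_dirichletHemisphere ht)
    (isBigO_dirichletHemisphere_heatTrace_expansion N) hβ
  have h1N : 1 < N + 1 := by omega
  have e : ((∑ k : Fin (N + 1) ⊕ Fin (N + 1), if Sum.elim (fun k : Fin (N + 1) ↦ ((k : ℕ) : ℝ) - 1) (fun i : Fin (N + 1) ↦ ((i : ℕ) : ℝ) - 1 / 2) k = 0 then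
      (((Sum.elim (fun k : Fin (N + 1) ↦ (∑ p ∈ Finset.HasAntidiagonal.antidiagonal (k : ℕ),
          (1 / 4 : ℝ) ^ p.1 / (p.1.factorial : ℝ) * ((-1 : ℝ) ^ p.2 * (2 / 4 ^ p.2 - 1) * (bernoulli (2 * p.2) : ℝ) /
            (p.2.factorial : ℝ))) / 2)
          (fun i : Fin (N + 1) ↦ (-1) * (π ^ (1 / 2 : ℝ) / 4) * ((1 / 4 : ℝ) ^ (i : ℕ) / ((i : ℕ).factorial : ℝ))) k : ℝ)) : ℂ) else 0) -
      ({i : (Σ l : ℕ, Fin l) | ((i.1 : ℝ) * (i.1 + 1)) = 0}.ncard : ℂ)) = (1 / 6) := by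
    rw [Fintype.sum_sum_type]
    simp only [Sum.elim_inl, Sum.elim_inr, hemisphereExponent_eq_iff N h1N 0 (by norm_num), Finset.sum_ite_eq',
      Finset.mem_univ, if_true, natCast_sub_half_ne_zero, if_false, Finset.sum_const_zero, add_zero,
      ncard_setOf_dirichletHemisphere_eq_zero, twoSphere_heatCoeff_one]
    push_cast
    norm_num
  rw [e] at h
  exact h

/-- **THE HALF-INTEGER POLE: `Res_{s=½} ζ_D = Γ(½)^{−1}·(−√π/4) = −1/4`** — the pole a closed surface does not have,
produced by the boundary term `−¼√(4πt)·area B/(4πt)` of McKean–Singer's (6). [cite: Gilkey1995, §1.10 Lemma 1.10.1;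
McKeanSinger1967, eq. (6) p. 45] -/
theorem tendsto_sub_half_mul_dirichletHemisphereZeta_continuation (N : ℕ) :
    Tendsto (fun s : ℂ ↦ (s - ((1 / 2 : ℝ) : ℂ)) * ((Complex.Gamma s)⁻¹ *
        (∑ k : Fin (N + 1) ⊕ Fin (N + 1), (((Sum.elim (fun k : Fin (N + 1) ↦ (∑ p ∈ Finset.HasAntidiagonal.antidiagonal (k : ℕ),
          (1 / 4 : ℝ) ^ p.1 / (p.1.factorial : ℝ) * ((-1 : ℝ) ^ p.2 * (2 / 4 ^ p.2 - 1) * (bernoulli (2 * p.2) : ℝ) /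
            (p.2.factorial : ℝ))) / 2)
          (fun i : Fin (N + 1) ↦ (-1) * (π ^ (1 / 2 : ℝ) / 4) * ((1 / 4 : ℝ) ^ (i : ℕ) / ((i : ℕ).factorial : ℝ))) k : ℝ)) : ℂ) / (s + ((Sum.elim (fun k : Fin (N + 1) ↦ ((k : ℕ) : ℝ) - 1) (fun i : Fin (N + 1) ↦ ((i : ℕ) : ℝ) - 1 / 2) k) : ℝ)) -
          ({i : (Σ l : ℕ, Fin l) | ((i.1 : ℝ) * (i.1 + 1)) = 0}.ncard : ℂ) / s +
        mellin (fun t : ℝ ↦ ((∑' i : {i : (Σ l : ℕ, Fin l) | ((i.1 : ℝ) * (i.1 + 1)) ≠ 0},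
            rexp (-(t * ((((i : (Σ l : ℕ, Fin l))).1 : ℝ) * (((i : (Σ l : ℕ, Fin l))).1 + 1)))) : ℝ) : ℂ) -
          (Ioc 0 1).indicator (fun t : ℝ ↦ ((∑ k : Fin (N + 1) ⊕ Fin (N + 1), Sum.elim (fun k : Fin (N + 1) ↦ (∑ p ∈ Finset.HasAntidiagonal.antidiagonal (k : ℕ),
          (1 / 4 : ℝ) ^ p.1 / (p.1.factorial : ℝ) * ((-1 : ℝ) ^ p.2 * (2 / 4 ^ p.2 - 1) * (bernoulli (2 * p.2) : ℝ) /
            (p.2.factorial : ℝ))) / 2)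
          (fun i : Fin (N + 1) ↦ (-1) * (π ^ (1 / 2 : ℝ) / 4) * ((1 / 4 : ℝ) ^ (i : ℕ) / ((i : ℕ).factorial : ℝ))) k *
            t ^ (Sum.elim (fun k : Fin (N + 1) ↦ ((k : ℕ) : ℝ) - 1) (fun i : Fin (N + 1) ↦ ((i : ℕ) : ℝ) - 1 / 2) k) : ℝ) : ℂ) -
            ({i : (Σ l : ℕ, Fin l) | ((i.1 : ℝ) * (i.1 + 1)) = 0}.ncard : ℂ)) t) s)))
      (𝓝[≠] ((1 / 2 : ℝ) : ℂ)) (𝓝 (-(1 / 4))) := by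
  have hs₀ : -(N : ℝ) < 1 / 2 := by linarith [(N.cast_nonneg : (0 : ℝ) ≤ N)]
  have h := tendsto_sub_mul_continuation_nhdsNE (μ := fun i : (Σ l : ℕ, Fin l) ↦ ((i.1 : ℝ) * (i.1 + 1)))
    (fun i ↦ by positivity) tendsto_dirichletHemisphere_cofinite_atTop (fun t ht ↦ summable_dirichletHemisphere ht)
    (isBigO_dirichletHemisphere_heatTrace_expansion N) hs₀
  have h0N : 0 < N + 1 := by omega
  have e : ((Complex.Gamma ((1 / 2 : ℝ) : ℂ))⁻¹ *
      ((∑ k : Fin (N + 1) ⊕ Fin (N + 1), if Sum.elim (fun k : Fin (N + 1) ↦ ((k : ℕ) : ℝ) - 1) (fun i : Fin (N + 1) ↦ ((i : ℕ) : ℝ) - 1 / 2) k = -(1 / 2 : ℝ) then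
        (((Sum.elim (fun k : Fin (N + 1) ↦ (∑ p ∈ Finset.HasAntidiagonal.antidiagonal (k : ℕ),
          (1 / 4 : ℝ) ^ p.1 / (p.1.factorial : ℝ) * ((-1 : ℝ) ^ p.2 * (2 / 4 ^ p.2 - 1) * (bernoulli (2 * p.2) : ℝ) /
            (p.2.factorial : ℝ))) / 2)
          (fun i : Fin (N + 1) ↦ (-1) * (π ^ (1 / 2 : ℝ) / 4) * ((1 / 4 : ℝ) ^ (i : ℕ) / ((i : ℕ).factorial : ℝ))) k : ℝ)) : ℂ) else 0) -
        if (1 / 2 : ℝ) = 0 then ({i : (Σ l : ℕ, Fin l) | ((i.1 : ℝ) * (i.1 + 1)) = 0}.ncard : ℂ) else 0)) = (-(1 / 4)) := by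
    rw [Fintype.sum_sum_type]
    simp only [Sum.elim_inl, Sum.elim_inr, natCast_sub_one_ne_neg_half, if_false, Finset.sum_const_zero, zero_add,
      hemisphereHalfExponent_eq_iff N h0N (-(1 / 2)) (by norm_num), Finset.sum_ite_eq', Finset.mem_univ, if_true,
      pow_zero, Nat.factorial_zero, Nat.cast_one, div_one, mul_one, Complex.Gamma_ofReal, Real.Gamma_one_half_eq,
      Real.sqrt_eq_rpow, show ¬ ((1 / 2 : ℝ) = 0) by norm_num, sub_zero]
    have hq : ((π ^ (1 / 2 : ℝ) : ℝ) : ℂ) ≠ 0 := Complex.ofReal_ne_zero.mpr (by positivity)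
    push_cast
    field_simp
  rw [e] at h
  exact h

/-- **WEYL'S LAW FOR THE NEUMANN HEMISPHERE: `#{λ ≤ Λ}/Λ → ½ = Area(S²₊)/(4π)`** — the boundary term `∓√π/(4√t)` is
invisible at Weyl order. [cite: Berard1986, Ch. VII nº10 (ii) (11); McKeanSinger1967, eq. (6) p. 45; FreitasMaoSalavessa2025,
§1.3] -/
theorem tendsto_ncard_neumannHemisphere_le_div :
    Tendsto (fun Λ : ℝ ↦ (({i : (Σ l : ℕ, Fin (l + 1)) | ((i.1 : ℝ) * (i.1 + 1)) ≤ Λ}.ncard : ℕ) : ℝ) / Λ) atTop (𝓝 (1 / 2)) := by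
  have hexp : (fun t : ℝ ↦ ∑' i : (Σ l : ℕ, Fin (l + 1)), rexp (-(((i.1 : ℝ) * (i.1 + 1)) * t)) -
      ∑ k : Fin (0 + 1) ⊕ Fin (0 + 1), Sum.elim (fun k : Fin (0 + 1) ↦ (∑ p ∈ Finset.HasAntidiagonal.antidiagonal (k : ℕ),
          (1 / 4 : ℝ) ^ p.1 / (p.1.factorial : ℝ) * ((-1 : ℝ) ^ p.2 * (2 / 4 ^ p.2 - 1) * (bernoulli (2 * p.2) : ℝ) /
            (p.2.factorial : ℝ))) / 2)
          (fun i : Fin (0 + 1) ↦ 1 * (π ^ (1 / 2 : ℝ) / 4) * ((1 / 4 : ℝ) ^ (i : ℕ) / ((i : ℕ).factorial : ℝ))) k *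
        t ^ (Sum.elim (fun k : Fin (0 + 1) ↦ ((k : ℕ) : ℝ) - 1) (fun i : Fin (0 + 1) ↦ ((i : ℕ) : ℝ) - 1 / 2) k)) =O[𝓝[>] 0] fun t : ℝ ↦ t ^ (((0 : ℕ) : ℝ)) := by
    refine ((isBigO_neumannHemisphere_heatTrace_expansion 0).congr' ?_ EventuallyEq.rfl)
    filter_upwards with t
    congr 1
    exact tsum_congr fun i ↦ by rw [mul_comm]
  have hsum : ∀ t : ℝ, 0 < t → Summable fun i : (Σ l : ℕ, Fin (l + 1)) ↦ rexp (-(((i.1 : ℝ) * (i.1 + 1)) * t)) :=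
    fun t ht ↦ (summable_neumannHemisphere ht).congr fun i ↦ by rw [mul_comm]
  have h := tendsto_ncard_le_div_rpow_of_expansion (μ := fun i : (Σ l : ℕ, Fin (l + 1)) ↦ ((i.1 : ℝ) * (i.1 + 1))) (ρ := (1 : ℝ))
    (fun i ↦ by positivity) hsum hexp (fun k ↦ ?_) (by simp) (by norm_num)
  swap
  · rcases k with k | i
    · simp
    · simp only [Sum.elim_inr]
      linarith [((i : ℕ).cast_nonneg : (0 : ℝ) ≤ (i : ℕ))]
  have h0 : 0 < 0 + 1 := Nat.succ_pos 0
  have e : (∑ k : Fin (0 + 1) ⊕ Fin (0 + 1), if Sum.elim (fun k : Fin (0 + 1) ↦ ((k : ℕ) : ℝ) - 1) (fun i : Fin (0 + 1) ↦ ((i : ℕ) : ℝ) - 1 / 2) k = -(1 : ℝ) then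
      Sum.elim (fun k : Fin (0 + 1) ↦ (∑ p ∈ Finset.HasAntidiagonal.antidiagonal (k : ℕ),
          (1 / 4 : ℝ) ^ p.1 / (p.1.factorial : ℝ) * ((-1 : ℝ) ^ p.2 * (2 / 4 ^ p.2 - 1) * (bernoulli (2 * p.2) : ℝ) /
            (p.2.factorial : ℝ))) / 2)
          (fun i : Fin (0 + 1) ↦ 1 * (π ^ (1 / 2 : ℝ) / 4) * ((1 / 4 : ℝ) ^ (i : ℕ) / ((i : ℕ).factorial : ℝ))) k else 0) / Real.Gamma ((1 : ℝ) + 1) = 1 / 2 := by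
    rw [show (1 : ℝ) + 1 = 2 by norm_num, Real.Gamma_two, Fintype.sum_sum_type]
    simp only [Sum.elim_inl, Sum.elim_inr, hemisphereExponent_eq_iff 0 h0 (-1) (by norm_num), Finset.sum_ite_eq',
      Finset.mem_univ, if_true, natCast_sub_half_ne_neg_one, if_false, Finset.sum_const_zero, add_zero,
      twoSphere_heatCoeff_zero, div_one]
  rw [e] at h
  refine h.congr' ?_
  filter_upwards with Λ
  rw [Real.rpow_one]

/-- **`ζ_N(0) = a₁ᴺ − dim ker Δ_N = 1/6 − 1 = −5/6`** — only the INTEGER powers of the expansion contribute at `s = 0`, and `t⁰` carries `a₁/2 = 1/6`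
(half of `χ(S²)/6 = 1/3`); the boundary terms sit at half-integer exponents. [cite: Gilkey1995, §1.10 Lemma 1.10.1;
McKeanSinger1967, eq. (6) p. 45; FreitasMaoSalavessa2025, §1.3] -/
theorem tendsto_neumannHemisphereZeta_continuation_nhdsNE_zero (N : ℕ) (hN : N ≠ 0) :
    Tendsto (fun s : ℂ ↦ (Complex.Gamma s)⁻¹ *
        (∑ k : Fin (N + 1) ⊕ Fin (N + 1), (((Sum.elim (fun k : Fin (N + 1) ↦ (∑ p ∈ Finset.HasAntidiagonal.antidiagonal (k : ℕ),
          (1 / 4 : ℝ) ^ p.1 / (p.1.factorial : ℝ) * ((-1 : ℝ) ^ p.2 * (2 / 4 ^ p.2 - 1) * (bernoulli (2 * p.2) : ℝ) /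
            (p.2.factorial : ℝ))) / 2)
          (fun i : Fin (N + 1) ↦ 1 * (π ^ (1 / 2 : ℝ) / 4) * ((1 / 4 : ℝ) ^ (i : ℕ) / ((i : ℕ).factorial : ℝ))) k : ℝ)) : ℂ) / (s + ((Sum.elim (fun k : Fin (N + 1) ↦ ((k : ℕ) : ℝ) - 1) (fun i : Fin (N + 1) ↦ ((i : ℕ) : ℝ) - 1 / 2) k) : ℝ)) -
          ({i : (Σ l : ℕ, Fin (l + 1)) | ((i.1 : ℝ) * (i.1 + 1)) = 0}.ncard : ℂ) / s +
        mellin (fun t : ℝ ↦ ((∑' i : {i : (Σ l : ℕ, Fin (l + 1)) | ((i.1 : ℝ) * (i.1 + 1)) ≠ 0},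
            rexp (-(t * ((((i : (Σ l : ℕ, Fin (l + 1)))).1 : ℝ) * (((i : (Σ l : ℕ, Fin (l + 1)))).1 + 1)))) : ℝ) : ℂ) -
          (Ioc 0 1).indicator (fun t : ℝ ↦ ((∑ k : Fin (N + 1) ⊕ Fin (N + 1), Sum.elim (fun k : Fin (N + 1) ↦ (∑ p ∈ Finset.HasAntidiagonal.antidiagonal (k : ℕ),
          (1 / 4 : ℝ) ^ p.1 / (p.1.factorial : ℝ) * ((-1 : ℝ) ^ p.2 * (2 / 4 ^ p.2 - 1) * (bernoulli (2 * p.2) : ℝ) /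
            (p.2.factorial : ℝ))) / 2)
          (fun i : Fin (N + 1) ↦ 1 * (π ^ (1 / 2 : ℝ) / 4) * ((1 / 4 : ℝ) ^ (i : ℕ) / ((i : ℕ).factorial : ℝ))) k *
            t ^ (Sum.elim (fun k : Fin (N + 1) ↦ ((k : ℕ) : ℝ) - 1) (fun i : Fin (N + 1) ↦ ((i : ℕ) : ℝ) - 1 / 2) k) : ℝ) : ℂ) -
            ({i : (Σ l : ℕ, Fin (l + 1)) | ((i.1 : ℝ) * (i.1 + 1)) = 0}.ncard : ℂ)) t) s))
      (𝓝[≠] 0) (𝓝 (-(5 / 6))) := by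
  have hβ : (0 : ℝ) < (N : ℝ) := by exact_mod_cast Nat.pos_of_ne_zero hN
  have h := tendsto_continuation_nhdsNE_zero (μ := fun i : (Σ l : ℕ, Fin (l + 1)) ↦ ((i.1 : ℝ) * (i.1 + 1)))
    (fun i ↦ by positivity) tendsto_neumannHemisphere_cofinite_atTop (fun t ht ↦ summable_neumannHemisphere ht)
    (isBigO_neumannHemisphere_heatTrace_expansion N) hβ
  have h1N : 1 < N + 1 := by omega
  have e : ((∑ k : Fin (N + 1) ⊕ Fin (N + 1), if Sum.elim (fun k : Fin (N + 1) ↦ ((k : ℕ) : ℝ) - 1) (fun i : Fin (N + 1) ↦ ((i : ℕ) : ℝ) - 1 / 2) k = 0 then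
      (((Sum.elim (fun k : Fin (N + 1) ↦ (∑ p ∈ Finset.HasAntidiagonal.antidiagonal (k : ℕ),
          (1 / 4 : ℝ) ^ p.1 / (p.1.factorial : ℝ) * ((-1 : ℝ) ^ p.2 * (2 / 4 ^ p.2 - 1) * (bernoulli (2 * p.2) : ℝ) /
            (p.2.factorial : ℝ))) / 2)
          (fun i : Fin (N + 1) ↦ 1 * (π ^ (1 / 2 : ℝ) / 4) * ((1 / 4 : ℝ) ^ (i : ℕ) / ((i : ℕ).factorial : ℝ))) k : ℝ)) : ℂ) else 0) -
      ({i : (Σ l : ℕ, Fin (l + 1)) | ((i.1 : ℝ) * (i.1 + 1)) = 0}.ncard : ℂ)) = (-(5 / 6)) := by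
    rw [Fintype.sum_sum_type]
    simp only [Sum.elim_inl, Sum.elim_inr, hemisphereExponent_eq_iff N h1N 0 (by norm_num), Finset.sum_ite_eq',
      Finset.mem_univ, if_true, natCast_sub_half_ne_zero, if_false, Finset.sum_const_zero, add_zero,
      ncard_setOf_neumannHemisphere_eq_zero, twoSphere_heatCoeff_one]
    push_cast
    norm_num
  rw [e] at h
  exact h

/-- **THE HALF-INTEGER POLE: `Res_{s=½} ζ_N = Γ(½)^{−1}·(+√π/4) = +1/4`** — the pole a closed surface does not have,
produced by the boundary term `+¼√(4πt)·area B/(4πt)` of McKean–Singer's (6). [cite: Gilkey1995, §1.10 Lemma 1.10.1;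
McKeanSinger1967, eq. (6) p. 45] -/
theorem tendsto_sub_half_mul_neumannHemisphereZeta_continuation (N : ℕ) :
    Tendsto (fun s : ℂ ↦ (s - ((1 / 2 : ℝ) : ℂ)) * ((Complex.Gamma s)⁻¹ *
        (∑ k : Fin (N + 1) ⊕ Fin (N + 1), (((Sum.elim (fun k : Fin (N + 1) ↦ (∑ p ∈ Finset.HasAntidiagonal.antidiagonal (k : ℕ),
          (1 / 4 : ℝ) ^ p.1 / (p.1.factorial : ℝ) * ((-1 : ℝ) ^ p.2 * (2 / 4 ^ p.2 - 1) * (bernoulli (2 * p.2) : ℝ) /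
            (p.2.factorial : ℝ))) / 2)
          (fun i : Fin (N + 1) ↦ 1 * (π ^ (1 / 2 : ℝ) / 4) * ((1 / 4 : ℝ) ^ (i : ℕ) / ((i : ℕ).factorial : ℝ))) k : ℝ)) : ℂ) / (s + ((Sum.elim (fun k : Fin (N + 1) ↦ ((k : ℕ) : ℝ) - 1) (fun i : Fin (N + 1) ↦ ((i : ℕ) : ℝ) - 1 / 2) k) : ℝ)) -
          ({i : (Σ l : ℕ, Fin (l + 1)) | ((i.1 : ℝ) * (i.1 + 1)) = 0}.ncard : ℂ) / s +
        mellin (fun t : ℝ ↦ ((∑' i : {i : (Σ l : ℕ, Fin (l + 1)) | ((i.1 : ℝ) * (i.1 + 1)) ≠ 0},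
            rexp (-(t * ((((i : (Σ l : ℕ, Fin (l + 1)))).1 : ℝ) * (((i : (Σ l : ℕ, Fin (l + 1)))).1 + 1)))) : ℝ) : ℂ) -
          (Ioc 0 1).indicator (fun t : ℝ ↦ ((∑ k : Fin (N + 1) ⊕ Fin (N + 1), Sum.elim (fun k : Fin (N + 1) ↦ (∑ p ∈ Finset.HasAntidiagonal.antidiagonal (k : ℕ),
          (1 / 4 : ℝ) ^ p.1 / (p.1.factorial : ℝ) * ((-1 : ℝ) ^ p.2 * (2 / 4 ^ p.2 - 1) * (bernoulli (2 * p.2) : ℝ) /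
            (p.2.factorial : ℝ))) / 2)
          (fun i : Fin (N + 1) ↦ 1 * (π ^ (1 / 2 : ℝ) / 4) * ((1 / 4 : ℝ) ^ (i : ℕ) / ((i : ℕ).factorial : ℝ))) k *
            t ^ (Sum.elim (fun k : Fin (N + 1) ↦ ((k : ℕ) : ℝ) - 1) (fun i : Fin (N + 1) ↦ ((i : ℕ) : ℝ) - 1 / 2) k) : ℝ) : ℂ) -
            ({i : (Σ l : ℕ, Fin (l + 1)) | ((i.1 : ℝ) * (i.1 + 1)) = 0}.ncard : ℂ)) t) s)))
      (𝓝[≠] ((1 / 2 : ℝ) : ℂ)) (𝓝 (1 / 4)) := by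
  have hs₀ : -(N : ℝ) < 1 / 2 := by linarith [(N.cast_nonneg : (0 : ℝ) ≤ N)]
  have h := tendsto_sub_mul_continuation_nhdsNE (μ := fun i : (Σ l : ℕ, Fin (l + 1)) ↦ ((i.1 : ℝ) * (i.1 + 1)))
    (fun i ↦ by positivity) tendsto_neumannHemisphere_cofinite_atTop (fun t ht ↦ summable_neumannHemisphere ht)
    (isBigO_neumannHemisphere_heatTrace_expansion N) hs₀
  have h0N : 0 < N + 1 := by omega
  have e : ((Complex.Gamma ((1 / 2 : ℝ) : ℂ))⁻¹ *
      ((∑ k : Fin (N + 1) ⊕ Fin (N + 1), if Sum.elim (fun k : Fin (N + 1) ↦ ((k : ℕ) : ℝ) - 1) (fun i : Fin (N + 1) ↦ ((i : ℕ) : ℝ) - 1 / 2) k = -(1 / 2 : ℝ) then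
        (((Sum.elim (fun k : Fin (N + 1) ↦ (∑ p ∈ Finset.HasAntidiagonal.antidiagonal (k : ℕ),
          (1 / 4 : ℝ) ^ p.1 / (p.1.factorial : ℝ) * ((-1 : ℝ) ^ p.2 * (2 / 4 ^ p.2 - 1) * (bernoulli (2 * p.2) : ℝ) /
            (p.2.factorial : ℝ))) / 2)
          (fun i : Fin (N + 1) ↦ 1 * (π ^ (1 / 2 : ℝ) / 4) * ((1 / 4 : ℝ) ^ (i : ℕ) / ((i : ℕ).factorial : ℝ))) k : ℝ)) : ℂ) else 0) -
        if (1 / 2 : ℝ) = 0 then ({i : (Σ l : ℕ, Fin (l + 1)) | ((i.1 : ℝ) * (i.1 + 1)) = 0}.ncard : ℂ) else 0)) = (1 / 4) := by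
    rw [Fintype.sum_sum_type]
    simp only [Sum.elim_inl, Sum.elim_inr, natCast_sub_one_ne_neg_half, if_false, Finset.sum_const_zero, zero_add,
      hemisphereHalfExponent_eq_iff N h0N (-(1 / 2)) (by norm_num), Finset.sum_ite_eq', Finset.mem_univ, if_true,
      pow_zero, Nat.factorial_zero, Nat.cast_one, div_one, mul_one, Complex.Gamma_ofReal, Real.Gamma_one_half_eq,
      Real.sqrt_eq_rpow, show ¬ ((1 / 2 : ℝ) = 0) by norm_num, sub_zero]
    have hq : ((π ^ (1 / 2 : ℝ) : ℝ) : ℂ) ≠ 0 := Complex.ofReal_ne_zero.mpr (by positivity)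
    push_cast
    field_simp
  rw [e] at h
  exact h

/-- **`ζ_D` IS REGULAR AT EVERY `s = −j`, WITH VALUE `(−1)ʲj!·a_{j+1}/2`** (`ζ_D(0) = 1/6`, `ζ_D(−1) = −1/30`,
`ζ_D(−2) = 4/315`): the half-integer exponents never meet the poles of `Γ`, so only the sphere half contributes.
[cite: Gilkey1995, §1.10 Lemma 1.10.1; FreitasMaoSalavessa2025, §2.2] -/
theorem exists_analyticAt_dirichletHemisphereZeta_continuation_neg_natCast (j : ℕ) :
    ∃ Z : ℂ → ℂ, AnalyticAt ℂ Z (-(j : ℂ)) ∧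
      Z (-(j : ℂ)) = (-1) ^ j * (j.factorial : ℂ) *
        ((((∑ p ∈ Finset.HasAntidiagonal.antidiagonal (j + 1), (1 / 4 : ℝ) ^ p.1 / (p.1.factorial : ℝ) *
          ((-1 : ℝ) ^ p.2 * (2 / 4 ^ p.2 - 1) * (bernoulli (2 * p.2) : ℝ) / (p.2.factorial : ℝ))) / 2 : ℝ) : ℂ)) ∧
      ∀ᶠ s in 𝓝[≠] (-(j : ℂ)), Z s = (Complex.Gamma s)⁻¹ *
        (∑ k : Fin ((j + 1) + 1) ⊕ Fin ((j + 1) + 1), (((Sum.elim (fun k : Fin ((j + 1) + 1) ↦ (∑ p ∈ Finset.HasAntidiagonal.antidiagonal (k : ℕ),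
          (1 / 4 : ℝ) ^ p.1 / (p.1.factorial : ℝ) * ((-1 : ℝ) ^ p.2 * (2 / 4 ^ p.2 - 1) * (bernoulli (2 * p.2) : ℝ) /
            (p.2.factorial : ℝ))) / 2)
          (fun i : Fin ((j + 1) + 1) ↦ (-1) * (π ^ (1 / 2 : ℝ) / 4) * ((1 / 4 : ℝ) ^ (i : ℕ) / ((i : ℕ).factorial : ℝ))) k : ℝ)) : ℂ) / (s + ((Sum.elim (fun k : Fin ((j + 1) + 1) ↦ ((k : ℕ) : ℝ) - 1) (fun i : Fin ((j + 1) + 1) ↦ ((i : ℕ) : ℝ) - 1 / 2) k) : ℝ)) -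
          ({i : (Σ l : ℕ, Fin l) | ((i.1 : ℝ) * (i.1 + 1)) = 0}.ncard : ℂ) / s +
        mellin (fun t : ℝ ↦ ((∑' i : {i : (Σ l : ℕ, Fin l) | ((i.1 : ℝ) * (i.1 + 1)) ≠ 0},
            rexp (-(t * ((((i : (Σ l : ℕ, Fin l))).1 : ℝ) * (((i : (Σ l : ℕ, Fin l))).1 + 1)))) : ℝ) : ℂ) -
          (Ioc 0 1).indicator (fun t : ℝ ↦ ((∑ k : Fin ((j + 1) + 1) ⊕ Fin ((j + 1) + 1), Sum.elim (fun k : Fin ((j + 1) + 1) ↦ (∑ p ∈ Finset.HasAntidiagonal.antidiagonal (k : ℕ),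
          (1 / 4 : ℝ) ^ p.1 / (p.1.factorial : ℝ) * ((-1 : ℝ) ^ p.2 * (2 / 4 ^ p.2 - 1) * (bernoulli (2 * p.2) : ℝ) /
            (p.2.factorial : ℝ))) / 2)
          (fun i : Fin ((j + 1) + 1) ↦ (-1) * (π ^ (1 / 2 : ℝ) / 4) * ((1 / 4 : ℝ) ^ (i : ℕ) / ((i : ℕ).factorial : ℝ))) k *
            t ^ (Sum.elim (fun k : Fin ((j + 1) + 1) ↦ ((k : ℕ) : ℝ) - 1) (fun i : Fin ((j + 1) + 1) ↦ ((i : ℕ) : ℝ) - 1 / 2) k) : ℝ) : ℂ) -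
            ({i : (Σ l : ℕ, Fin l) | ((i.1 : ℝ) * (i.1 + 1)) = 0}.ncard : ℂ)) t) s) := by
  have hβ : (j : ℝ) < (((j + 1 : ℕ)) : ℝ) := by push_cast; linarith
  obtain ⟨Z, hZ, hval, hev⟩ := exists_analyticAt_continuation_neg_natCast (μ := fun i : (Σ l : ℕ, Fin l) ↦ ((i.1 : ℝ) * (i.1 + 1)))
    (fun i ↦ by positivity) tendsto_dirichletHemisphere_cofinite_atTop (fun t ht ↦ summable_dirichletHemisphere ht)
    (isBigO_dirichletHemisphere_heatTrace_expansion (j + 1)) j hβ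
  refine ⟨Z, hZ, ?_, hev⟩
  rw [hval, Fintype.sum_sum_type]
  have hj : j + 1 < (j + 1) + 1 := by omega
  simp only [Sum.elim_inl, Sum.elim_inr, hemisphereExponent_eq_iff (j + 1) hj (j : ℝ) (by push_cast; ring),
    Finset.sum_ite_eq', Finset.mem_univ, if_true, natCast_sub_half_ne_natCast, if_false, Finset.sum_const_zero,
    add_zero, ncard_setOf_dirichletHemisphere_eq_zero, Nat.cast_zero, ite_self, sub_zero]

/-- **THE POLE AT `s = 1`: `Res_{s=1} ζ_D = Γ(1)^{−1}·a₀/2 = ½`** (`= Area(S²₊)/(4π)`). [cite: Gilkey1995, §1.10 Lemma 1.10.1;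
Berard1986, Ch. VII nº2 (`a₀ = Vol`)] -/
theorem tendsto_sub_one_mul_dirichletHemisphereZeta_continuation (N : ℕ) :
    Tendsto (fun s : ℂ ↦ (s - ((1 : ℝ) : ℂ)) * ((Complex.Gamma s)⁻¹ *
        (∑ k : Fin (N + 1) ⊕ Fin (N + 1), (((Sum.elim (fun k : Fin (N + 1) ↦ (∑ p ∈ Finset.HasAntidiagonal.antidiagonal (k : ℕ),
          (1 / 4 : ℝ) ^ p.1 / (p.1.factorial : ℝ) * ((-1 : ℝ) ^ p.2 * (2 / 4 ^ p.2 - 1) * (bernoulli (2 * p.2) : ℝ) /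
            (p.2.factorial : ℝ))) / 2)
          (fun i : Fin (N + 1) ↦ (-1) * (π ^ (1 / 2 : ℝ) / 4) * ((1 / 4 : ℝ) ^ (i : ℕ) / ((i : ℕ).factorial : ℝ))) k : ℝ)) : ℂ) / (s + ((Sum.elim (fun k : Fin (N + 1) ↦ ((k : ℕ) : ℝ) - 1) (fun i : Fin (N + 1) ↦ ((i : ℕ) : ℝ) - 1 / 2) k) : ℝ)) -
          ({i : (Σ l : ℕ, Fin l) | ((i.1 : ℝ) * (i.1 + 1)) = 0}.ncard : ℂ) / s +
        mellin (fun t : ℝ ↦ ((∑' i : {i : (Σ l : ℕ, Fin l) | ((i.1 : ℝ) * (i.1 + 1)) ≠ 0},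
            rexp (-(t * ((((i : (Σ l : ℕ, Fin l))).1 : ℝ) * (((i : (Σ l : ℕ, Fin l))).1 + 1)))) : ℝ) : ℂ) -
          (Ioc 0 1).indicator (fun t : ℝ ↦ ((∑ k : Fin (N + 1) ⊕ Fin (N + 1), Sum.elim (fun k : Fin (N + 1) ↦ (∑ p ∈ Finset.HasAntidiagonal.antidiagonal (k : ℕ),
          (1 / 4 : ℝ) ^ p.1 / (p.1.factorial : ℝ) * ((-1 : ℝ) ^ p.2 * (2 / 4 ^ p.2 - 1) * (bernoulli (2 * p.2) : ℝ) /
            (p.2.factorial : ℝ))) / 2)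
          (fun i : Fin (N + 1) ↦ (-1) * (π ^ (1 / 2 : ℝ) / 4) * ((1 / 4 : ℝ) ^ (i : ℕ) / ((i : ℕ).factorial : ℝ))) k *
            t ^ (Sum.elim (fun k : Fin (N + 1) ↦ ((k : ℕ) : ℝ) - 1) (fun i : Fin (N + 1) ↦ ((i : ℕ) : ℝ) - 1 / 2) k) : ℝ) : ℂ) -
            ({i : (Σ l : ℕ, Fin l) | ((i.1 : ℝ) * (i.1 + 1)) = 0}.ncard : ℂ)) t) s)))
      (𝓝[≠] ((1 : ℝ) : ℂ)) (𝓝 (1 / 2)) := by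
  have hs₀ : -(N : ℝ) < 1 := by linarith [(N.cast_nonneg : (0 : ℝ) ≤ N)]
  have h := tendsto_sub_mul_continuation_nhdsNE (μ := fun i : (Σ l : ℕ, Fin l) ↦ ((i.1 : ℝ) * (i.1 + 1)))
    (fun i ↦ by positivity) tendsto_dirichletHemisphere_cofinite_atTop (fun t ht ↦ summable_dirichletHemisphere ht)
    (isBigO_dirichletHemisphere_heatTrace_expansion N) hs₀
  have h0N : 0 < N + 1 := by omega
  have e : ((Complex.Gamma ((1 : ℝ) : ℂ))⁻¹ *
      ((∑ k : Fin (N + 1) ⊕ Fin (N + 1), if Sum.elim (fun k : Fin (N + 1) ↦ ((k : ℕ) : ℝ) - 1) (fun i : Fin (N + 1) ↦ ((i : ℕ) : ℝ) - 1 / 2) k = -(1 : ℝ) then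
        (((Sum.elim (fun k : Fin (N + 1) ↦ (∑ p ∈ Finset.HasAntidiagonal.antidiagonal (k : ℕ),
          (1 / 4 : ℝ) ^ p.1 / (p.1.factorial : ℝ) * ((-1 : ℝ) ^ p.2 * (2 / 4 ^ p.2 - 1) * (bernoulli (2 * p.2) : ℝ) /
            (p.2.factorial : ℝ))) / 2)
          (fun i : Fin (N + 1) ↦ (-1) * (π ^ (1 / 2 : ℝ) / 4) * ((1 / 4 : ℝ) ^ (i : ℕ) / ((i : ℕ).factorial : ℝ))) k : ℝ)) : ℂ) else 0) -
        if (1 : ℝ) = 0 then ({i : (Σ l : ℕ, Fin l) | ((i.1 : ℝ) * (i.1 + 1)) = 0}.ncard : ℂ) else 0)) = 1 / 2 := by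
    rw [Fintype.sum_sum_type]
    simp only [Sum.elim_inl, Sum.elim_inr, hemisphereExponent_eq_iff N h0N (-1) (by norm_num), Finset.sum_ite_eq',
      Finset.mem_univ, if_true, natCast_sub_half_ne_neg_one, if_false, Finset.sum_const_zero, add_zero,
      one_ne_zero, sub_zero, twoSphere_heatCoeff_zero, Complex.ofReal_one, Complex.Gamma_one, inv_one, one_mul]
    push_cast
    ring
  rw [e] at h
  exact h

end Literature.Analysis.InnerProduct
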